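import Literature.NumberTheory.LFunctions.BondarenkoHeap2026Section2Proofs
import Literature.Analysis.Fourier.PaleyWienerSchwartzBounded
import Literature.Analysis.SpecialFunctions.DigammaVerticalSeries
import Literature.NumberTheory.LFunctions.ExplicitFormulaBandLimited
import HarnessLib

/-!
# Bondarenko–Heap 2026, Proposition 1 — module (M1): the test function `B_{T,h}` of the
# explicit formula (entire extension, growth, band limit, polar terms)

LABEL (cell `rh-crit`, corpus C5 `ah`): **NOT RH-BEARING.** This is the first module of the
`proposition1_holds` programme (lead ruling R-g5-8; plan HOME/HANDOFF.md § rh-crit-ah-t1): the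
objects of [BondarenkoHeap2026, §2.2, p. 6, TeX l.283–305] —

* `B_{T,h}(u) = ∫ 𝟙_{|u−t|<h/2} |R(t)|² W_T(t) dt` **(4)** and, "for complex `z`",
  `B_{T,h}(z) = ∫_{−h/2}^{h/2} R(t+z) R̄(t+z) W_T(t+z) dt`, `R̄(z) = Σ_{n ≤ L} r(n) n^{−1/2+iz}`,

typed as honest definitions over the §2 vocabulary of `BondarenkoHeap2026Section2.lean`
(`Prop1.PhiC`, `Prop1.weightC`, `Prop1.dirichletPolyC`, `Prop1.dirichletPolyBarC`, `Prop1.GC`,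
`Prop1.BC`), together with the four hypotheses of the tree's Guinand–Weil formula
`Literature.NumberTheory.LFunctions.tsum_zeros_shift_eq_explicit` (Balazard–de Roton 2008, Prop. 11)
for `F = B_{T,h}`, all PROVED:

* `Prop1.differentiable_BC` — `B_{T,h}` is entire (differentiation under the integral sign; `Φ = 𝓕⁻φ`
  is entire as a Fourier–Laplace integral, `PaleyWienerSchwartz.hasDerivAt_integral_mul_cexp`);
* `Prop1.exists_bound_BC` — the two-bump majorant `|B_{T,h}(x+iy)| ≤ K e^{2πΔ|y|}((1+(x−T)²)⁻¹ +
  (1+(x+T)²)⁻¹)` with `Δ = Prop1.Delta = log L/π + 2σ/T + B + 1` (Paley–Wiener bounds of every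
  order for `Φ`, `Prop1.norm_integral_mul_cexp_le_pow`, by `2N` integrations by parts);
* `Prop1.fourier_BC_eq`, `Prop1.fourier_BC_eq_zero` — "as a convolution"
  `B̂_{T,h}(ξ) = (sin πhξ/πξ) Σ_{m,n ≤ L} r(m)r(n)(mn)^{−1/2} Ŵ_T(ξ + log(m/n)/2π)` (Mathlib's
  `Real.fourier_mul_convolution_eq`, `Prop1.fourier_normSq_mul_weight_eq`) and `B̂_{T,h}(ξ) = 0` for
  `|ξ| > log L/2π + 2σ/T` (by **(2)**, `weightHat_support_holds`);
* `Prop1.integrable_BC_mul_reDigammaQuarter` — `B_{T,h}(u) Re ψ(¼ + iu/2)` is integrable;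

the formula itself applied to `B_{T,h}` at `t = 0`, `Prop1.explicit_formula_BC` (M4's starting point),
and the size of the polar terms, `Prop1.norm_BC_polar_le`: `|B_{T,h}(±i/2)| ≤ h (Σ|r(n)|)² L ·
2e^{2πσ}‖φ‖₁² T^{−2B}` ("`B_{T,h}(±i/2) ≪ L^{1+ε} T^{−2B}`", p. 6). On the real line every object
agrees with §2 (`Prop1.BC_ofReal`, `Prop1.GC_ofReal`, …). No named facts; RH is not mentioned.
Nothing here bears on the truth of RH.

## References

* [BondarenkoHeap2026] A. Bondarenko, W. Heap, arXiv:2608.07399v1, §2.2 "Application of the explicit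
  formula", p. 6 (TeX l.283–305: (4), `B̂_{T,h}` as a convolution, `B_{T,h}(z)` for complex `z`,
  the polar terms). [cite: BondarenkoHeap2026, §2.2 p. 6]
* [HormanderALPDO1] L. Hörmander, *The analysis of linear partial differential operators I*,
  Thm. 7.3.1 (Paley–Wiener–Schwartz estimates by integration by parts).
* [Katznelson2004] Y. Katznelson, *An introduction to harmonic analysis*, VI.1 (elementary properties
  of the Fourier transform on `ℝ`: modulation, transforms of indicators, convolution).
* [BalazardDeRoton2008] M. Balazard, A. de Roton, arXiv:0810.3587, Prop. 11 (the shape of the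
  hypotheses: `ExplicitFormulaBandLimited.lean`).
-/

noncomputable section

open Complex Filter MeasureTheory Set
open scoped Real FourierTransform ContDiff Convolution

namespace Literature.NumberTheory.LFunctions

namespace BondarenkoHeap2026

namespace Prop1

open Literature.Analysis.Fourier.PaleyWienerSchwartz WeightCalculus

/-! ### The complexified objects -/

/-- `Φ(ζ) = ∫ φ(ξ) e^{2πiζξ} dξ` for complex `ζ` — the entire extension of `Φ = 𝓕⁻φ`.
[cite: BondarenkoHeap2026, §2.1 p. 5 (Φ = φ̂ entire)] -/
def PhiC (w : Bump) (ζ : ℂ) : ℂ :=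
  ∫ ξ : ℝ, (w.φ ξ : ℂ) * cexp (2 * π * I * ζ * ξ)

/-- On the real line `Φ_ℂ = Φ`. [cite: BondarenkoHeap2026, §2.1 p. 5 (Φ)] -/
theorem PhiC_ofReal (w : Bump) (x : ℝ) : PhiC w x = (Phi w x : ℂ) := by
  rw [Phi_eq, Real.fourierInv_eq']
  unfold PhiC
  refine integral_congr_ae (ae_of_all _ fun ξ ↦ ?_)
  simp only [smul_eq_mul, RCLike.inner_apply, conj_trivial]
  rw [mul_comm]
  congr 1
  congr 1
  push_cast
  ring

/-- `W_T(z) = ((z² + 1/4)/T²)^B {Φ(z/T − 1)² + Φ(z/T + 1)²}` for complex `z` ((1), entire).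
[cite: BondarenkoHeap2026, §2.1 (1) p. 5] -/
def weightC (w : Bump) (B : ℕ) (T : ℝ) (z : ℂ) : ℂ :=
  ((z ^ 2 + 1 / 4) / (T : ℂ) ^ 2) ^ B * (PhiC w (z / T - 1) ^ 2 + PhiC w (z / T + 1) ^ 2)

/-- On the real line `W_ℂ = W_T`. [cite: BondarenkoHeap2026, §2.1 (1) p. 5] -/
theorem weightC_ofReal (w : Bump) (B : ℕ) (T t : ℝ) : weightC w B T t = (weight w B T t : ℂ) := by
  unfold weightC weight
  have h1 : (t : ℂ) / T - 1 = ((t / T - 1 : ℝ) : ℂ) := by push_cast; ring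
  have h2 : (t : ℂ) / T + 1 = ((t / T + 1 : ℝ) : ℂ) := by push_cast; ring
  rw [h1, h2, PhiC_ofReal, PhiC_ofReal]
  push_cast
  ring

/-- `R(z) = Σ_{n ≤ L} r(n) n^{−1/2 − iz}` for complex `z`. [cite: BondarenkoHeap2026, §2.2 p. 6 (B_{T,h}(z))] -/
def dirichletPolyC (r : ℕ → ℝ) (L : ℝ) (z : ℂ) : ℂ :=
  ∑ n ∈ Finset.Icc 1 ⌊L⌋₊, (r n : ℂ) * (n : ℂ) ^ (-(1 / 2 : ℂ) - z * I)

/-- `R̄(z) = Σ_{n ≤ L} r(n) n^{−1/2 + iz}` (p. 6, TeX l.297–300). [cite: BondarenkoHeap2026, §2.2 p. 6 (R̄(z))] -/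
def dirichletPolyBarC (r : ℕ → ℝ) (L : ℝ) (z : ℂ) : ℂ :=
  ∑ n ∈ Finset.Icc 1 ⌊L⌋₊, (r n : ℂ) * (n : ℂ) ^ (-(1 / 2 : ℂ) + z * I)

/-- On the real line `R_ℂ = R`. [cite: BondarenkoHeap2026, §2.1 p. 5 (R(t))] -/
theorem dirichletPolyC_ofReal (r : ℕ → ℝ) (L t : ℝ) : dirichletPolyC r L t = dirichletPoly r L t := rfl

/-- On the real line `R̄(t) = conj R(t)` (real coefficients). [cite: BondarenkoHeap2026, §2.2 p. 6 (R̄(z))] -/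
theorem dirichletPolyBarC_ofReal (r : ℕ → ℝ) (L t : ℝ) :
    dirichletPolyBarC r L t = (starRingEnd ℂ) (dirichletPoly r L t) := by
  rw [← Extension.dirichletPoly_neg]
  unfold dirichletPolyBarC dirichletPoly
  refine Finset.sum_congr rfl fun n _ ↦ ?_
  rw [Complex.ofReal_neg, neg_mul, sub_neg_eq_add]

/-- On the real line `R(t) R̄(t) = |R(t)|²`. [cite: BondarenkoHeap2026, §2.2 p. 6 (B_{T,h}(z))] -/
theorem dirichletPolyC_mul_bar_ofReal (r : ℕ → ℝ) (L t : ℝ) :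
    dirichletPolyC r L t * dirichletPolyBarC r L t = ((‖dirichletPoly r L t‖ ^ 2 : ℝ) : ℂ) := by
  rw [dirichletPolyC_ofReal, dirichletPolyBarC_ofReal, Complex.mul_conj, Complex.normSq_eq_norm_sq]

/-- `G(z) = R(z) R̄(z) W_T(z)`, the entire extension of `|R(t)|² W_T(t)`. [cite: BondarenkoHeap2026, §2.2 p. 6 (B_{T,h}(z))] -/
def GC (w : Bump) (B : ℕ) (r : ℕ → ℝ) (L T : ℝ) (z : ℂ) : ℂ :=
  dirichletPolyC r L z * dirichletPolyBarC r L z * weightC w B T z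

/-- On the real line `G = |R|² W_T`. [cite: BondarenkoHeap2026, §2.2 (4) p. 6] -/
theorem GC_ofReal (w : Bump) (B : ℕ) (r : ℕ → ℝ) (L T t : ℝ) :
    GC w B r L T t = ((‖dirichletPoly r L t‖ ^ 2 * weight w B T t : ℝ) : ℂ) := by
  unfold GC
  rw [dirichletPolyC_mul_bar_ofReal, weightC_ofReal]
  push_cast
  ring

/-- **`B_{T,h}(z) = ∫_{−h/2}^{h/2} R(t+z) R̄(t+z) W_T(t+z) dt`** for complex `z` (p. 6, TeX l.295–296),
`h = 2πc/log T`. [cite: BondarenkoHeap2026, §2.2 (4) p. 6 (B_{T,h}(z))] -/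
def BC (c : ℝ) (w : Bump) (B : ℕ) (r : ℕ → ℝ) (L T : ℝ) (z : ℂ) : ℂ :=
  ∫ s in (-(gapWidth c T / 2))..(gapWidth c T / 2), GC w B r L T (s + z)

/-- On the real line **(4)**: `B_{T,h}(u) = ∫_{|u−t| ≤ h/2} |R(t)|² W_T(t) dt`. [cite: BondarenkoHeap2026, §2.2 (4) p. 6] -/
theorem BC_ofReal {c T : ℝ} (hh : 0 ≤ gapWidth c T) (w : Bump) (B : ℕ) (r : ℕ → ℝ) (L : ℝ)
    (u : ℝ) :
    BC c w B r L T u = ((∫ t in Set.Icc (u - gapWidth c T / 2) (u + gapWidth c T / 2),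
      ‖dirichletPoly r L t‖ ^ 2 * weight w B T t : ℝ) : ℂ) := by
  unfold BC
  set F : ℝ → ℂ := fun x ↦ (((‖dirichletPoly r L x‖ ^ 2 * weight w B T x : ℝ)) : ℂ) with hF
  have h1 : ∀ s : ℝ, GC w B r L T ((s : ℂ) + (u : ℂ)) = F (s + u) := fun s ↦ by
    rw [← Complex.ofReal_add]; exact GC_ofReal w B r L T (s + u)
  simp_rw [h1]
  rw [intervalIntegral.integral_comp_add_right F u]
  simp only [hF]
  rw [intervalIntegral.integral_ofReal, intervalIntegral.integral_of_le (by linarith),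
    integral_Icc_eq_integral_Ioc]
  congr 2
  ring

/-! ### Holomorphy -/

/-- `Φ_ℂ` is entire. [cite: BondarenkoHeap2026, §2.1 p. 5 (W_T entire)] -/
theorem differentiable_PhiC (w : Bump) : Differentiable ℂ (PhiC w) := fun ζ ↦
  (hasDerivAt_integral_mul_cexp (contDiff_phiC w).continuous (hasCompactSupport_phiC w) ζ).differentiableAt

/-- `W_ℂ` is entire ("`W_T` is even and entire", p. 5). [cite: BondarenkoHeap2026, §2.1 (1) p. 5] -/
theorem differentiable_weightC (w : Bump) (B : ℕ) (T : ℝ) : Differentiable ℂ (weightC w B T) := by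
  have hΦ := differentiable_PhiC w
  unfold weightC
  fun_prop

/-- `R_ℂ` is entire. [cite: BondarenkoHeap2026, §2.2 p. 6 (B_{T,h}(z))] -/
theorem differentiable_dirichletPolyC (r : ℕ → ℝ) (L : ℝ) : Differentiable ℂ (dirichletPolyC r L) := by
  unfold dirichletPolyC
  refine Differentiable.fun_sum fun n hn ↦ ?_
  have hn0 : (n : ℂ) ≠ 0 := by
    have : 1 ≤ n := (Finset.mem_Icc.mp hn).1
    exact_mod_cast (by omega : n ≠ 0)
  exact (Differentiable.const_cpow (by fun_prop) (Or.inl hn0)).const_mul _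

/-- `R̄_ℂ` is entire. [cite: BondarenkoHeap2026, §2.2 p. 6 (R̄(z))] -/
theorem differentiable_dirichletPolyBarC (r : ℕ → ℝ) (L : ℝ) :
    Differentiable ℂ (dirichletPolyBarC r L) := by
  unfold dirichletPolyBarC
  refine Differentiable.fun_sum fun n hn ↦ ?_
  have hn0 : (n : ℂ) ≠ 0 := by
    have : 1 ≤ n := (Finset.mem_Icc.mp hn).1
    exact_mod_cast (by omega : n ≠ 0)
  exact (Differentiable.const_cpow (by fun_prop) (Or.inl hn0)).const_mul _

/-- `G` is entire. [cite: BondarenkoHeap2026, §2.2 p. 6 (B_{T,h}(z))] -/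
theorem differentiable_GC (w : Bump) (B : ℕ) (r : ℕ → ℝ) (L T : ℝ) :
    Differentiable ℂ (GC w B r L T) :=
  ((differentiable_dirichletPolyC r L).mul (differentiable_dirichletPolyBarC r L)).mul
    (differentiable_weightC w B T)

/-- `B_{T,h}` is entire, with `B'(z) = ∫_{−h/2}^{h/2} G'(s + z) ds` (differentiation under the
integral sign). [cite: BondarenkoHeap2026, §2.2 p. 6 (B_{T,h}(z))] -/
theorem hasDerivAt_BC (c : ℝ) (w : Bump) (B : ℕ) (r : ℕ → ℝ) (L T : ℝ) (z₀ : ℂ) :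
    HasDerivAt (BC c w B r L T)
      (∫ s in (-(gapWidth c T / 2))..(gapWidth c T / 2), deriv (GC w B r L T) (s + z₀)) z₀ := by
  set G := GC w B r L T with hGdef
  set a : ℝ := -(gapWidth c T / 2)
  set b : ℝ := gapWidth c T / 2
  have hG : Differentiable ℂ G := differentiable_GC w B r L T
  have hGc : Continuous G := hG.continuous
  have hG' : Continuous (deriv G) := (hG.contDiff (n := 1)).continuous_deriv le_rfl
  -- a uniform bound for `G'` on `[a, b] + closedBall z₀ 1`
  obtain ⟨C, hC⟩ := ((isCompact_uIcc (a := a) (b := b)).prod (isCompact_closedBall z₀ (1 : ℝ)))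
    |>.exists_bound_of_continuousOn (f := fun p : ℝ × ℂ ↦ deriv G ((p.1 : ℂ) + p.2))
      ((hG'.comp ((continuous_ofReal.comp continuous_fst).add continuous_snd)).continuousOn)
  have key := intervalIntegral.hasDerivAt_integral_of_dominated_loc_of_deriv_le
    (𝕜 := ℂ) (μ := volume) (a := a) (b := b) (s := Metric.ball z₀ 1)
    (F := fun (z : ℂ) (s : ℝ) ↦ G ((s : ℂ) + z)) (F' := fun (z : ℂ) (s : ℝ) ↦ deriv G ((s : ℂ) + z))
    (x₀ := z₀) (bound := fun _ ↦ C) (Metric.ball_mem_nhds z₀ one_pos)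
    (Eventually.of_forall fun z ↦
      (hGc.comp (continuous_ofReal.add continuous_const)).aestronglyMeasurable)
    ((hGc.comp (continuous_ofReal.add continuous_const)).intervalIntegrable _ _)
    (hG'.comp (continuous_ofReal.add continuous_const)).aestronglyMeasurable
    (ae_of_all _ fun s hs z hz ↦
      hC ⟨s, z⟩ ⟨Set.uIoc_subset_uIcc hs, Metric.ball_subset_closedBall hz⟩)
    intervalIntegrable_const
    (ae_of_all _ fun s _ z _ ↦ by
      simpa using (hG ((s : ℂ) + z)).hasDerivAt.comp_const_add (s : ℂ) z)
  exact key.2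

/-- `B_{T,h}` is entire. [cite: BondarenkoHeap2026, §2.2 p. 6 (B_{T,h}(z))] -/
theorem differentiable_BC (c : ℝ) (w : Bump) (B : ℕ) (r : ℕ → ℝ) (L T : ℝ) :
    Differentiable ℂ (BC c w B r L T) := fun z ↦ (hasDerivAt_BC c w B r L T z).differentiableAt


/-! ### The real side: `|R(t)|²` as an exponential sum; Fourier transforms -/

/-- The Fourier integrand `e^{−2πivw} f(v)` is integrable when `f` is. [folklore] -/
private theorem integrable_exp_smul' {f : ℝ → ℂ} (hf : Integrable f) (w : ℝ) :
    Integrable fun v : ℝ ↦ cexp (↑(-2 * π * v * w) * I) • f v := by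
  have hcont : Continuous fun v : ℝ ↦ cexp (↑(-2 * π * v * w) * I) := by fun_prop
  refine hf.bdd_mul (c := 1) hcont.aestronglyMeasurable (ae_of_all _ fun v ↦ ?_)
  rw [Complex.norm_exp_ofReal_mul_I]

/-- **Modulation**: `𝓕[e^{iat} f](ξ) = 𝓕[f](ξ − a/2π)`. [cite: Katznelson2004, VI.1] -/
theorem fourier_cexp_mul (f : ℝ → ℂ) (a ξ : ℝ) :
    𝓕 (fun t : ℝ ↦ cexp (I * t * a) * f t) ξ = 𝓕 f (ξ - a / (2 * π)) := by
  rw [Real.fourier_real_eq_integral_exp_smul, Real.fourier_real_eq_integral_exp_smul]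
  refine integral_congr_ae (ae_of_all _ fun t ↦ ?_)
  simp only [smul_eq_mul]
  rw [← mul_assoc, ← Complex.exp_add]
  congr 2
  have hπ : (π : ℂ) ≠ 0 := by exact_mod_cast Real.pi_ne_zero
  push_cast
  field_simp
  ring

/-- `n^{−1/2 + s} = n^{−1/2} e^{s log n}` (`n ≥ 1`). [folklore] -/
private theorem natCast_cpow_half_add {n : ℕ} (hn : 1 ≤ n) (s : ℂ) :
    (n : ℂ) ^ (-(1 / 2 : ℂ) + s) = (((n : ℝ) ^ (-(1 / 2 : ℝ)) : ℝ) : ℂ) * cexp (Real.log n * s) := by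
  have hn0 : (n : ℂ) ≠ 0 := by exact_mod_cast (by omega : n ≠ 0)
  rw [Complex.cpow_add _ _ hn0, Complex.cpow_def_of_ne_zero hn0 s, ← Complex.natCast_log,
    Complex.ofReal_cpow (Nat.cast_nonneg n)]
  push_cast
  rfl

/-- **`|R(t)|² = Σ_{m,n ≤ L} r(m) r(n) (mn)^{−1/2} e^{it log(n/m)}`** (real coefficients).
[cite: BondarenkoHeap2026, §2.2 p. 6 (B̂_{T,h} as a convolution)] -/
theorem normSq_dirichletPoly_eq (r : ℕ → ℝ) (L t : ℝ) :
    (((‖dirichletPoly r L t‖ ^ 2 : ℝ)) : ℂ) =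
      ∑ m ∈ Finset.Icc 1 ⌊L⌋₊, ∑ n ∈ Finset.Icc 1 ⌊L⌋₊,
        ((r m * r n * ((m : ℝ) * n) ^ (-(1 / 2 : ℝ)) : ℝ) : ℂ) *
          cexp (I * t * (Real.log n - Real.log m)) := by
  rw [← dirichletPolyC_mul_bar_ofReal]
  unfold dirichletPolyC dirichletPolyBarC
  rw [Finset.sum_mul_sum]
  refine Finset.sum_congr rfl fun m hm ↦ Finset.sum_congr rfl fun n hn ↦ ?_
  have hm1 : 1 ≤ m := (Finset.mem_Icc.mp hm).1
  have hn1 : 1 ≤ n := (Finset.mem_Icc.mp hn).1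
  rw [show (-(1 / 2 : ℂ) - (t : ℂ) * I) = -(1 / 2 : ℂ) + (-(t * I)) by ring,
    natCast_cpow_half_add hm1, natCast_cpow_half_add hn1,
    Real.mul_rpow (Nat.cast_nonneg m) (Nat.cast_nonneg n)]
  push_cast
  rw [show cexp (I * (t : ℂ) * (Complex.log (n : ℂ) - Complex.log (m : ℂ))) =
      cexp (Complex.log (m : ℂ) * -((t : ℂ) * I)) * cexp (Complex.log (n : ℂ) * ((t : ℂ) * I)) by
    rw [← Complex.exp_add]; congr 1; ring]
  ring

/-- The integrand `|R|² W_T` is integrable on `ℝ` (`T > 0`). [cite: BondarenkoHeap2026, §2.1 (2) p. 5] -/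
theorem integrable_normSq_mul_weight (w : Bump) (B : ℕ) (r : ℕ → ℝ) (L : ℝ) {T : ℝ} (hT : 0 < T) :
    Integrable fun t : ℝ ↦ ‖dirichletPoly r L t‖ ^ 2 * weight w B T t := by
  set S : ℝ := ∑ n ∈ Finset.Icc 1 ⌊L⌋₊, |r n| with hS
  have hR : ∀ t : ℝ, ‖dirichletPoly r L t‖ ≤ S := by
    intro t
    unfold dirichletPoly
    refine (norm_sum_le _ _).trans (Finset.sum_le_sum fun n hn ↦ ?_)
    have hn0 : 0 < n := (Finset.mem_Icc.mp hn).1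
    rw [norm_mul, Complex.norm_real, Real.norm_eq_abs, Complex.norm_natCast_cpow_of_pos hn0]
    have hre : (-(1 / 2 : ℂ) - t * I).re = -(1 / 2) := by simp
    rw [hre]
    have : (n : ℝ) ^ (-(1 / 2 : ℝ)) ≤ 1 :=
      Real.rpow_le_one_of_one_le_of_nonpos (by exact_mod_cast hn0) (by norm_num)
    calc |r n| * (n : ℝ) ^ (-(1 / 2 : ℝ)) ≤ |r n| * 1 := by gcongr
      _ = |r n| := mul_one _
  have hS0 : 0 ≤ S := le_trans (norm_nonneg _) (hR 0)
  refine ((Extension.integrable_weight w B hT).const_mul (S ^ 2)).mono'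
    (((continuous_dirichletPoly r L).norm.pow 2).mul (continuous_weight w B T)).aestronglyMeasurable
    (ae_of_all _ fun t ↦ ?_)
  rw [Real.norm_eq_abs, abs_of_nonneg (mul_nonneg (sq_nonneg _) (weight_nonneg w B T t))]
  exact mul_le_mul_of_nonneg_right (pow_le_pow_left₀ (norm_nonneg _) (hR t) 2) (weight_nonneg w B T t)

/-- **`𝓕[|R|² W_T](ξ) = Σ_{m,n ≤ L} r(m)r(n)(mn)^{−1/2} Ŵ_T(ξ + log(m/n)/2π)`** (the `m,n`-sum
in `B̂_{T,h}`, p. 6). [cite: BondarenkoHeap2026, §2.2 p. 6 (B̂_{T,h})] -/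
theorem fourier_normSq_mul_weight_eq (w : Bump) (B : ℕ) (r : ℕ → ℝ) (L : ℝ) {T : ℝ} (hT : 0 < T)
    (ξ : ℝ) :
    𝓕 (fun t : ℝ ↦ (((‖dirichletPoly r L t‖ ^ 2 * weight w B T t : ℝ)) : ℂ)) ξ =
      ∑ m ∈ Finset.Icc 1 ⌊L⌋₊, ∑ n ∈ Finset.Icc 1 ⌊L⌋₊,
        ((r m * r n * ((m : ℝ) * n) ^ (-(1 / 2 : ℝ)) : ℝ) : ℂ) *
          𝓕 (fun t : ℝ ↦ (weight w B T t : ℂ)) (ξ + (Real.log m - Real.log n) / (2 * π)) := by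
  set W : ℝ → ℂ := fun t ↦ (weight w B T t : ℂ) with hW
  have hWi : Integrable W := (Extension.integrable_weight w B hT).ofReal
  -- expand the integrand
  have hexp : (fun t : ℝ ↦ (((‖dirichletPoly r L t‖ ^ 2 * weight w B T t : ℝ)) : ℂ)) = fun t : ℝ ↦
      ∑ m ∈ Finset.Icc 1 ⌊L⌋₊, ∑ n ∈ Finset.Icc 1 ⌊L⌋₊,
        ((r m * r n * ((m : ℝ) * n) ^ (-(1 / 2 : ℝ)) : ℝ) : ℂ) *
          (cexp (I * t * (Real.log n - Real.log m)) * W t) := by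
    funext t
    rw [Complex.ofReal_mul, normSq_dirichletPoly_eq, Finset.sum_mul]
    refine Finset.sum_congr rfl fun m _ ↦ ?_
    rw [Finset.sum_mul]
    refine Finset.sum_congr rfl fun n _ ↦ ?_
    ring
  rw [hexp, Real.fourier_real_eq_integral_exp_smul]
  -- pull the finite sums out of the integral
  have hterm : ∀ m n : ℕ, Integrable fun t : ℝ ↦ cexp (↑(-2 * π * t * ξ) * I) •
      (((r m * r n * ((m : ℝ) * n) ^ (-(1 / 2 : ℝ)) : ℝ) : ℂ) *
        (cexp (I * t * (Real.log n - Real.log m)) * W t)) := by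
    intro m n
    refine integrable_exp_smul' (Integrable.const_mul ?_ _) ξ
    have hc : Continuous fun t : ℝ ↦ cexp (I * t * (Real.log n - Real.log m)) := by fun_prop
    refine hWi.bdd_mul (c := 1) hc.aestronglyMeasurable (ae_of_all _ fun t ↦ ?_)
    rw [show I * (t : ℂ) * (↑(Real.log ↑n) - ↑(Real.log ↑m)) =
      ↑(t * (Real.log n - Real.log m)) * I by push_cast; ring, Complex.norm_exp_ofReal_mul_I]
  simp_rw [Finset.smul_sum]
  rw [integral_finsetSum _ fun m _ ↦ integrable_finsetSum _ fun n _ ↦ hterm m n]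
  refine Finset.sum_congr rfl fun m _ ↦ ?_
  rw [integral_finsetSum _ fun n _ ↦ hterm m n]
  refine Finset.sum_congr rfl fun n _ ↦ ?_
  -- one term: `∫ e(−tξ) • (c · (e^{it a} W)) = c · 𝓕[e^{ita} W](ξ) = c · Ŵ(ξ − a/2π)`
  have h1 : (fun t : ℝ ↦ cexp (↑(-2 * π * t * ξ) * I) •
      (((r m * r n * ((m : ℝ) * n) ^ (-(1 / 2 : ℝ)) : ℝ) : ℂ) *
        (cexp (I * t * (Real.log n - Real.log m)) * W t))) = fun t : ℝ ↦
      ((r m * r n * ((m : ℝ) * n) ^ (-(1 / 2 : ℝ)) : ℝ) : ℂ) *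
        (cexp (↑(-2 * π * t * ξ) * I) • (cexp (I * t * ↑(Real.log n - Real.log m)) * W t)) := by
    funext t; push_cast; simp only [smul_eq_mul]; ring
  rw [h1, integral_const_mul, ← Real.fourier_real_eq_integral_exp_smul,
    fourier_cexp_mul W (Real.log n - Real.log m) ξ]
  congr 2
  ring

/-- **The Fourier transform of the window** `𝟙_{(−a,a)}`: `= 2a·sinc(2πaξ) = sin(2πaξ)/(πξ)`.
[cite: Katznelson2004, VI.1] -/
theorem fourier_indicator_Ioo {a : ℝ} (ha : 0 < a) (ξ : ℝ) :
    𝓕 ((Set.Ioo (-a) a).indicator fun _ : ℝ ↦ (1 : ℂ)) ξ = ((2 * a * Real.sinc (2 * π * a * ξ) : ℝ) : ℂ) := by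
  rw [Real.fourier_real_eq_integral_exp_smul]
  have h1 : (fun v : ℝ ↦ cexp (↑(-2 * π * v * ξ) * I) • (Set.Ioo (-a) a).indicator (fun _ : ℝ ↦ (1 : ℂ)) v)
      = (Set.Ioo (-a) a).indicator fun v : ℝ ↦ cexp (↑(-2 * π * v * ξ) * I) := by
    funext v
    by_cases hv : v ∈ Set.Ioo (-a) a
    · rw [Set.indicator_of_mem hv, Set.indicator_of_mem hv, smul_eq_mul, mul_one]
    · rw [Set.indicator_of_notMem hv, Set.indicator_of_notMem hv, smul_zero]
  rw [h1, integral_indicator measurableSet_Ioo, ← integral_Ioc_eq_integral_Ioo,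
    ← intervalIntegral.integral_of_le (by linarith)]
  by_cases hξ : ξ = 0
  · subst hξ
    simp only [mul_zero, Complex.ofReal_zero, zero_mul, Complex.exp_zero, Real.sinc_zero, mul_one]
    rw [intervalIntegral.integral_const, Complex.real_smul, mul_one]
    push_cast; ring
  · have hc : (-(2 * π * ξ) * I : ℂ) ≠ 0 := by
      simp [Real.pi_ne_zero, hξ, Complex.I_ne_zero]
    have h2 : (fun v : ℝ ↦ cexp (↑(-2 * π * v * ξ) * I)) = fun v : ℝ ↦ cexp ((-(2 * π * ξ) * I) * v) := by
      funext v; congr 1; push_cast; ring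
    rw [h2, integral_exp_mul_complex hc]
    have hx : 2 * π * a * ξ ≠ 0 :=
      mul_ne_zero (mul_ne_zero (mul_ne_zero two_ne_zero Real.pi_ne_zero) ha.ne') hξ
    rw [Real.sinc_of_ne_zero hx, div_eq_iff hc]
    have hθ1 : cexp (-(2 * π * ξ) * I * (a : ℂ)) = cexp (-((2 * π * a * ξ : ℝ) : ℂ) * I) := by
      congr 1; push_cast; ring
    have hθ2 : cexp (-(2 * π * ξ) * I * ((-a : ℝ) : ℂ)) = cexp (((2 * π * a * ξ : ℝ) : ℂ) * I) := by
      congr 1; push_cast; ring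
    rw [hθ1, hθ2]
    have hX : cexp (-((2 * π * a * ξ : ℝ) : ℂ) * I) - cexp (((2 * π * a * ξ : ℝ) : ℂ) * I) =
        -(2 * Complex.sin ((2 * π * a * ξ : ℝ) : ℂ) * I) := by
      rw [Complex.two_sin]
      simp only [mul_assoc, Complex.I_mul_I, mul_neg, mul_one, neg_neg]
    rw [hX]
    have hπ : (π : ℂ) ≠ 0 := by exact_mod_cast Real.pi_ne_zero
    have haC : (a : ℂ) ≠ 0 := by exact_mod_cast ha.ne'
    have hξC : (ξ : ℂ) ≠ 0 := by exact_mod_cast hξ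
    push_cast
    field_simp


/-- The window `𝟙_{(−h/2,h/2)}` (as a complex function) is integrable. [folklore] -/
private theorem integrable_window (a : ℝ) :
    Integrable ((Set.Ioo (-a) a).indicator fun _ : ℝ ↦ (1 : ℂ)) := by
  refine IntegrableOn.integrable_indicator ?_ measurableSet_Ioo
  exact integrableOn_const (by exact measure_Ioo_lt_top.ne)

/-- On the real line `B_{T,h} = (|R|² W_T) ∗ 𝟙_{(−h/2,h/2)}` ("as a convolution", p. 6).
[cite: BondarenkoHeap2026, §2.2 p. 6 (B̂_{T,h})] -/
theorem BC_ofReal_eq_convolution {c T : ℝ} (hh : 0 ≤ gapWidth c T) (w : Bump) (B : ℕ)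
    (r : ℕ → ℝ) (L u : ℝ) :
    BC c w B r L T u =
      ((fun t : ℝ ↦ (((‖dirichletPoly r L t‖ ^ 2 * weight w B T t : ℝ)) : ℂ)) ⋆[ContinuousLinearMap.mul ℂ ℂ]
        ((Set.Ioo (-(gapWidth c T / 2)) (gapWidth c T / 2)).indicator fun _ : ℝ ↦ (1 : ℂ))) u := by
  rw [convolution_def, BC_ofReal hh]
  simp only [ContinuousLinearMap.mul_apply']
  set g : ℝ → ℂ := fun t ↦ (((‖dirichletPoly r L t‖ ^ 2 * weight w B T t : ℝ)) : ℂ) with hg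
  have h1 : (fun t : ℝ ↦ g t * (Set.Ioo (-(gapWidth c T / 2)) (gapWidth c T / 2)).indicator
      (fun _ : ℝ ↦ (1 : ℂ)) (u - t)) =
      (Set.Ioo (u - gapWidth c T / 2) (u + gapWidth c T / 2)).indicator g := by
    funext t
    by_cases ht : t ∈ Set.Ioo (u - gapWidth c T / 2) (u + gapWidth c T / 2)
    · have hut : u - t ∈ Set.Ioo (-(gapWidth c T / 2)) (gapWidth c T / 2) :=
        ⟨by linarith [ht.2], by linarith [ht.1]⟩
      rw [Set.indicator_of_mem hut, Set.indicator_of_mem ht, mul_one]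
    · have hut : u - t ∉ Set.Ioo (-(gapWidth c T / 2)) (gapWidth c T / 2) := fun h' ↦
        ht ⟨by linarith [h'.2], by linarith [h'.1]⟩
      rw [Set.indicator_of_notMem hut, Set.indicator_of_notMem ht, mul_zero]
  rw [h1, integral_indicator measurableSet_Ioo, ← integral_Icc_eq_integral_Ioo, hg,
    integral_complex_ofReal]

/-- **`B̂_{T,h}(ξ) = (sin(πhξ)/(πξ)) · Σ_{m,n ≤ L} r(m)r(n)(mn)^{−1/2} Ŵ_T(ξ + log(m/n)/2π)`**, in the
form `B̂ = 𝓕[|R|²W_T] · (h sinc(πhξ))` (p. 6, "as a convolution"); the `m,n`-sum is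
`fourier_normSq_mul_weight_eq`. [cite: BondarenkoHeap2026, §2.2 p. 6 (B̂_{T,h})] -/
theorem fourier_BC_eq {c T : ℝ} (hT : 0 < T) (hh : 0 < gapWidth c T) (w : Bump) (B : ℕ)
    (r : ℕ → ℝ) (L ξ : ℝ) :
    𝓕 (fun u : ℝ ↦ BC c w B r L T u) ξ =
      𝓕 (fun t : ℝ ↦ (((‖dirichletPoly r L t‖ ^ 2 * weight w B T t : ℝ)) : ℂ)) ξ *
        ((gapWidth c T * Real.sinc (π * gapWidth c T * ξ) : ℝ) : ℂ) := by
  have hconv : (fun u : ℝ ↦ BC c w B r L T u) =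
      ((fun t : ℝ ↦ (((‖dirichletPoly r L t‖ ^ 2 * weight w B T t : ℝ)) : ℂ)) ⋆[ContinuousLinearMap.mul ℂ ℂ]
        ((Set.Ioo (-(gapWidth c T / 2)) (gapWidth c T / 2)).indicator fun _ : ℝ ↦ (1 : ℂ))) :=
    funext fun u ↦ BC_ofReal_eq_convolution hh.le w B r L u
  rw [hconv]
  have h := Real.fourier_mul_convolution_eq (integrable_normSq_mul_weight w B r L hT).ofReal
    (integrable_window (gapWidth c T / 2)) ξ
  rw [fourier_indicator_Ioo (half_pos hh), show (2 * (gapWidth c T / 2) *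
    Real.sinc (2 * π * (gapWidth c T / 2) * ξ)) = gapWidth c T * Real.sinc (π * gapWidth c T * ξ) by
      ring_nf] at h
  exact h

/-- **(2) transported to `B̂`:** `B̂_{T,h}(ξ) = 0` for `|ξ| > log L/2π + 2σ/T` ("since `B̂` has
compact support", p. 6). [cite: BondarenkoHeap2026, §2.2 p. 6 (B̂ has compact support)] -/
theorem fourier_BC_eq_zero {c T L : ℝ} (hT : 0 < T) (hh : 0 < gapWidth c T) (hL : 1 ≤ L)
    (w : Bump) (B : ℕ) (r : ℕ → ℝ) {ξ : ℝ} (hξ : Real.log L / (2 * π) + 2 * w.σ / T < |ξ|) :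
    𝓕 (fun u : ℝ ↦ BC c w B r L T u) ξ = 0 := by
  rw [fourier_BC_eq hT hh, fourier_normSq_mul_weight_eq w B r L hT, Finset.sum_eq_zero, zero_mul]
  intro m hm
  refine Finset.sum_eq_zero fun n hn ↦ ?_
  have hm1 : (1 : ℝ) ≤ m := by exact_mod_cast (Finset.mem_Icc.mp hm).1
  have hn1 : (1 : ℝ) ≤ n := by exact_mod_cast (Finset.mem_Icc.mp hn).1
  have hL0 : 0 < L := by linarith
  have hmL : (m : ℝ) ≤ L := le_trans (by exact_mod_cast (Finset.mem_Icc.mp hm).2) (Nat.floor_le hL0.le)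
  have hnL : (n : ℝ) ≤ L := le_trans (by exact_mod_cast (Finset.mem_Icc.mp hn).2) (Nat.floor_le hL0.le)
  have h0m : 0 ≤ Real.log m := Real.log_nonneg hm1
  have h0n : 0 ≤ Real.log n := Real.log_nonneg hn1
  have hmL' : Real.log m ≤ Real.log L := Real.log_le_log (by linarith) hmL
  have hnL' : Real.log n ≤ Real.log L := Real.log_le_log (by linarith) hnL
  have key : |(Real.log m - Real.log n) / (2 * π)| ≤ Real.log L / (2 * π) := by
    rw [abs_div, abs_of_pos (by positivity : (0 : ℝ) < 2 * π)]
    gcongr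
    rw [abs_le]; constructor <;> linarith
  have htri := abs_sub_abs_le_abs_sub ξ (-((Real.log m - Real.log n) / (2 * π)))
  rw [abs_neg, sub_neg_eq_add] at htri
  rw [weightHat_support_holds w B T hT _ (by linarith), mul_zero]

/-! ### Growth in the complex plane: Paley–Wiener bounds of every order for `Φ_ℂ` -/

/-- The iterated derivatives of a `C^∞_c` function are `C^∞_c`, with no larger support. [folklore] -/
private theorem iterate_deriv_aux {χ : ℝ → ℂ} (hχ : ContDiff ℝ ∞ χ) (hsupp : HasCompactSupport χ) (n : ℕ) :
    ContDiff ℝ ∞ (deriv^[n] χ) ∧ HasCompactSupport (deriv^[n] χ) ∧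
      tsupport (deriv^[n] χ) ⊆ tsupport χ := by
  induction n with
  | zero => exact ⟨hχ, hsupp, subset_rfl⟩
  | succ n ih =>
    obtain ⟨h1, h2, h3⟩ := ih
    rw [Function.iterate_succ']
    exact ⟨h1.iterate_deriv 1, h2.deriv, tsupport_deriv_subset.trans h3⟩

/-- **`n`-fold integration by parts**: `∫ χ^{(n)}(ξ) e^{2πiwξ} dξ = (−2πiw)^n ∫ χ(ξ) e^{2πiwξ} dξ`
for `χ ∈ C^∞_c`. [cite: HormanderALPDO1, Thm 7.3.1 (proof)] -/
theorem integral_iterate_deriv_mul_cexp {χ : ℝ → ℂ} (hχ : ContDiff ℝ ∞ χ)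
    (hsupp : HasCompactSupport χ) (n : ℕ) (w : ℂ) :
    ∫ ξ : ℝ, deriv^[n] χ ξ * cexp (2 * π * I * w * ξ) =
      (-(2 * π * I * w)) ^ n * ∫ ξ : ℝ, χ ξ * cexp (2 * π * I * w * ξ) := by
  induction n with
  | zero => simp
  | succ n ih =>
    obtain ⟨h1, h2, -⟩ := iterate_deriv_aux hχ hsupp n
    have h1' : ContDiff ℝ 1 (deriv^[n] χ) := h1.of_le (mod_cast le_top)
    rw [Function.iterate_succ']
    simp only [Function.comp_apply]
    rw [integral_deriv_mul_cexp h1' h2 w, ih]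
    ring

/-- `(2π|w|)^n |∫ χ(ξ) e^{2πiwξ} dξ| ≤ e^{2πR|Im w|} ‖χ^{(n)}‖₁` for `χ ∈ C^∞_c` with
`tsupport χ ⊆ [−R, R]`. [cite: HormanderALPDO1, Thm 7.3.1] -/
theorem pow_mul_norm_integral_mul_cexp_le {χ : ℝ → ℂ} {R : ℝ} (hχ : ContDiff ℝ ∞ χ)
    (hsupp : HasCompactSupport χ) (hR : tsupport χ ⊆ Icc (-R) R) (n : ℕ) (w : ℂ) :
    (2 * π * ‖w‖) ^ n * ‖∫ ξ : ℝ, χ ξ * cexp (2 * π * I * w * ξ)‖ ≤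
      Real.exp (2 * π * R * |w.im|) * ∫ ξ : ℝ, ‖deriv^[n] χ ξ‖ := by
  obtain ⟨h1, h2, h3⟩ := iterate_deriv_aux hχ hsupp n
  have h := norm_integral_mul_cexp_le (h1.continuous.integrable_of_hasCompactSupport h2)
    (h3.trans hR) w
  rw [integral_iterate_deriv_mul_cexp hχ hsupp n w, norm_mul, norm_pow, norm_neg] at h
  have hn : ‖(2 * π * I * w : ℂ)‖ = 2 * π * ‖w‖ := by
    simp [abs_of_pos Real.pi_pos]
  rwa [hn] at h

/-- `(1 + x²)^N ≤ 2^N (1 + x^{2N})`. [folklore] -/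
private theorem one_add_sq_pow_le (x : ℝ) (N : ℕ) : (1 + x ^ 2) ^ N ≤ 2 ^ N * (1 + x ^ (2 * N)) := by
  have hx2N : 0 ≤ x ^ (2 * N) := by rw [pow_mul]; exact pow_nonneg (sq_nonneg x) N
  rcases le_or_gt (x ^ 2) 1 with h | h
  · calc (1 + x ^ 2) ^ N ≤ 2 ^ N := pow_le_pow_left₀ (by positivity) (by linarith) N
      _ ≤ 2 ^ N * (1 + x ^ (2 * N)) := le_mul_of_one_le_right (by positivity) (by linarith)
  · calc (1 + x ^ 2) ^ N ≤ (2 * x ^ 2) ^ N := pow_le_pow_left₀ (by positivity) (by linarith) N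
      _ = 2 ^ N * x ^ (2 * N) := by rw [mul_pow, pow_mul]
      _ ≤ 2 ^ N * (1 + x ^ (2 * N)) := by gcongr; linarith

/-- **Paley–Wiener kernel estimate of order `N`.** For `χ ∈ C^∞_c` with `tsupport χ ⊆ [−R, R]`:
`|∫ χ(ξ) e^{2πiwξ} dξ| ≤ 2^N e^{2πR|Im w|} (‖χ‖₁ + ‖χ^{(2N)}‖₁) / (1 + |w|²)^N` — exponential type
`2πR` with decay of order `2N` (`2N` integrations by parts). [cite: HormanderALPDO1, Thm 7.3.1] -/
theorem norm_integral_mul_cexp_le_pow {χ : ℝ → ℂ} {R : ℝ} (hχ : ContDiff ℝ ∞ χ)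
    (hsupp : HasCompactSupport χ) (hR : tsupport χ ⊆ Icc (-R) R) (N : ℕ) (w : ℂ) :
    ‖∫ ξ : ℝ, χ ξ * cexp (2 * π * I * w * ξ)‖ ≤
      2 ^ N * Real.exp (2 * π * R * |w.im|) *
        ((∫ ξ : ℝ, ‖χ ξ‖) + ∫ ξ : ℝ, ‖deriv^[2 * N] χ ξ‖) / (1 + ‖w‖ ^ 2) ^ N := by
  set G : ℝ := ‖∫ ξ : ℝ, χ ξ * cexp (2 * π * I * w * ξ)‖ with hG
  set E : ℝ := Real.exp (2 * π * R * |w.im|) with hE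
  have hG0 : 0 ≤ G := norm_nonneg _
  have hJ0 : 0 ≤ ∫ ξ : ℝ, ‖χ ξ‖ := integral_nonneg fun _ ↦ norm_nonneg _
  have hJ : 0 ≤ ∫ ξ : ℝ, ‖deriv^[2 * N] χ ξ‖ := integral_nonneg fun _ ↦ norm_nonneg _
  have h0 : G ≤ E * ∫ ξ : ℝ, ‖χ ξ‖ := by
    have := pow_mul_norm_integral_mul_cexp_le hχ hsupp hR 0 w
    simpa [hG, hE] using this
  have h2N : (2 * π * ‖w‖) ^ (2 * N) * G ≤ E * ∫ ξ : ℝ, ‖deriv^[2 * N] χ ξ‖ :=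
    pow_mul_norm_integral_mul_cexp_le hχ hsupp hR (2 * N) w
  have hπ : ‖w‖ ^ (2 * N) ≤ (2 * π * ‖w‖) ^ (2 * N) := by
    rw [mul_pow]
    exact le_mul_of_one_le_left (pow_nonneg (norm_nonneg _) _)
      (one_le_pow₀ (by linarith [Real.two_le_pi]))
  have hsq := one_add_sq_pow_le ‖w‖ N
  rw [le_div_iff₀ (by positivity)]
  calc G * (1 + ‖w‖ ^ 2) ^ N ≤ G * (2 ^ N * (1 + ‖w‖ ^ (2 * N))) :=
        mul_le_mul_of_nonneg_left hsq hG0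
    _ = 2 ^ N * (G + ‖w‖ ^ (2 * N) * G) := by ring
    _ ≤ 2 ^ N * (E * (∫ ξ : ℝ, ‖χ ξ‖) + E * ∫ ξ : ℝ, ‖deriv^[2 * N] χ ξ‖) :=
        mul_le_mul_of_nonneg_left
          (add_le_add h0 ((mul_le_mul_of_nonneg_right hπ hG0).trans h2N)) (by positivity)
    _ = 2 ^ N * E * ((∫ ξ : ℝ, ‖χ ξ‖) + ∫ ξ : ℝ, ‖deriv^[2 * N] χ ξ‖) := by ring


/-- `tsupport φ ⊆ [−σ, σ]` for the complexified bump. [cite: BondarenkoHeap2026, §2.1 p. 5 (φ and σ)] -/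
theorem tsupport_phiC_subset (w : Bump) : tsupport (fun ξ : ℝ ↦ (w.φ ξ : ℂ)) ⊆ Set.Icc (-w.σ) w.σ := by
  have h : Function.support (fun ξ : ℝ ↦ (w.φ ξ : ℂ)) = Function.support w.φ :=
    Function.support_comp_eq Complex.ofReal (fun {x} ↦ Complex.ofReal_eq_zero) w.φ
  have ht : tsupport (fun ξ : ℝ ↦ (w.φ ξ : ℂ)) = tsupport w.φ := by
    simp only [tsupport, h]
  rw [ht]
  exact w.tsupport_subset.trans Set.Ioo_subset_Icc_self

/-- `L¹`-size of `φ` and of its `2N`-th derivative (the constant in the order-`N` Paley–Wiener bound).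
[cite: BondarenkoHeap2026, §2.1 p. 5 (φ)] -/
def phiNorm (w : Bump) (N : ℕ) : ℝ :=
  (∫ ξ : ℝ, ‖(w.φ ξ : ℂ)‖) + ∫ ξ : ℝ, ‖deriv^[2 * N] (fun ξ : ℝ ↦ (w.φ ξ : ℂ)) ξ‖

/-- `‖φ‖_N ≥ 0`. [cite: BondarenkoHeap2026, §2.1 p. 5 (φ)] -/
theorem phiNorm_nonneg (w : Bump) (N : ℕ) : 0 ≤ phiNorm w N :=
  add_nonneg (integral_nonneg fun _ ↦ norm_nonneg _) (integral_nonneg fun _ ↦ norm_nonneg _)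

/-- **Paley–Wiener bound of order `N` for `Φ_ℂ`:** `|Φ(ζ)| ≤ 2^N e^{2πσ|Im ζ|} ‖φ‖_{N} / (1+|ζ|²)^N`
("rapid decay of `Φ`", p. 6; `Φ` has exponential type `2πσ`). [cite: BondarenkoHeap2026, §2.1 p. 5–6 (Φ)] -/
theorem norm_PhiC_le (w : Bump) (N : ℕ) (ζ : ℂ) :
    ‖PhiC w ζ‖ ≤ 2 ^ N * Real.exp (2 * π * w.σ * |ζ.im|) * phiNorm w N / (1 + ‖ζ‖ ^ 2) ^ N :=
  norm_integral_mul_cexp_le_pow (contDiff_phiC w) (hasCompactSupport_phiC w) (tsupport_phiC_subset w) N ζ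

/-- The crude bound `|Φ(ζ)| ≤ e^{2πσ|Im ζ|} ‖φ‖₁`. [cite: BondarenkoHeap2026, §2.1 p. 5 (Φ)] -/
theorem norm_PhiC_le_exp (w : Bump) (ζ : ℂ) :
    ‖PhiC w ζ‖ ≤ Real.exp (2 * π * w.σ * |ζ.im|) * ∫ ξ : ℝ, ‖(w.φ ξ : ℂ)‖ :=
  norm_integral_mul_cexp_le w.integrable (tsupport_phiC_subset w) ζ

/-- `|R(ζ)| ≤ (Σ_{n ≤ L} |r(n)|) e^{|Im ζ| log L}` (`L ≥ 1`). [cite: BondarenkoHeap2026, §2.2 p. 6 (B_{T,h}(z))] -/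
theorem norm_dirichletPolyC_le {L : ℝ} (hL : 1 ≤ L) (r : ℕ → ℝ) (ζ : ℂ) :
    ‖dirichletPolyC r L ζ‖ ≤ (∑ n ∈ Finset.Icc 1 ⌊L⌋₊, |r n|) * Real.exp (|ζ.im| * Real.log L) := by
  unfold dirichletPolyC
  rw [Finset.sum_mul]
  refine (norm_sum_le _ _).trans (Finset.sum_le_sum fun n hn ↦ ?_)
  have hn0 : 0 < n := (Finset.mem_Icc.mp hn).1
  have hn1 : (1 : ℝ) ≤ n := by exact_mod_cast hn0
  have hL0 : 0 < L := by linarith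
  have hnL : (n : ℝ) ≤ L := le_trans (by exact_mod_cast (Finset.mem_Icc.mp hn).2) (Nat.floor_le hL0.le)
  rw [norm_mul, Complex.norm_real, Real.norm_eq_abs, Complex.norm_natCast_cpow_of_pos hn0]
  refine mul_le_mul_of_nonneg_left ?_ (abs_nonneg _)
  have hre : (-(1 / 2 : ℂ) - ζ * I).re = -(1 / 2) + ζ.im := by simp
  rw [hre]
  calc (n : ℝ) ^ (-(1 / 2) + ζ.im) ≤ (n : ℝ) ^ |ζ.im| :=
        Real.rpow_le_rpow_of_exponent_le hn1 (by linarith [le_abs_self ζ.im])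
    _ ≤ L ^ |ζ.im| := Real.rpow_le_rpow (by positivity) hnL (abs_nonneg _)
    _ = Real.exp (|ζ.im| * Real.log L) := by rw [Real.rpow_def_of_pos hL0, mul_comm]

/-- `|R̄(ζ)| ≤ (Σ_{n ≤ L} |r(n)|) e^{|Im ζ| log L}` (`L ≥ 1`). [cite: BondarenkoHeap2026, §2.2 p. 6 (R̄(z))] -/
theorem norm_dirichletPolyBarC_le {L : ℝ} (hL : 1 ≤ L) (r : ℕ → ℝ) (ζ : ℂ) :
    ‖dirichletPolyBarC r L ζ‖ ≤ (∑ n ∈ Finset.Icc 1 ⌊L⌋₊, |r n|) * Real.exp (|ζ.im| * Real.log L) := by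
  unfold dirichletPolyBarC
  rw [Finset.sum_mul]
  refine (norm_sum_le _ _).trans (Finset.sum_le_sum fun n hn ↦ ?_)
  have hn0 : 0 < n := (Finset.mem_Icc.mp hn).1
  have hn1 : (1 : ℝ) ≤ n := by exact_mod_cast hn0
  have hL0 : 0 < L := by linarith
  have hnL : (n : ℝ) ≤ L := le_trans (by exact_mod_cast (Finset.mem_Icc.mp hn).2) (Nat.floor_le hL0.le)
  rw [norm_mul, Complex.norm_real, Real.norm_eq_abs, Complex.norm_natCast_cpow_of_pos hn0]
  refine mul_le_mul_of_nonneg_left ?_ (abs_nonneg _)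
  have hre : (-(1 / 2 : ℂ) + ζ * I).re = -(1 / 2) - ζ.im := by simp; ring
  rw [hre]
  calc (n : ℝ) ^ (-(1 / 2) - ζ.im) ≤ (n : ℝ) ^ |ζ.im| :=
        Real.rpow_le_rpow_of_exponent_le hn1 (by linarith [neg_abs_le ζ.im])
    _ ≤ L ^ |ζ.im| := Real.rpow_le_rpow (by positivity) hnL (abs_nonneg _)
    _ = Real.exp (|ζ.im| * Real.log L) := by rw [Real.rpow_def_of_pos hL0, mul_comm]

/-- `|ζ² + 1/4| ≤ (1 + (Re ζ)²)(1 + (Im ζ)²)`. [folklore] -/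
private theorem norm_sq_add_quarter_le (ζ : ℂ) : ‖ζ ^ 2 + 1 / 4‖ ≤ (1 + ζ.re ^ 2) * (1 + ζ.im ^ 2) := by
  calc ‖ζ ^ 2 + 1 / 4‖ ≤ ‖ζ ^ 2‖ + ‖(1 / 4 : ℂ)‖ := norm_add_le _ _
    _ = ζ.re ^ 2 + ζ.im ^ 2 + 1 / 4 := by
        rw [norm_pow, Complex.sq_norm, Complex.normSq_apply]; norm_num; ring
    _ ≤ (1 + ζ.re ^ 2) * (1 + ζ.im ^ 2) := by nlinarith [sq_nonneg ζ.re, sq_nonneg ζ.im]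

/-- `(1 + v²)^B ≤ e^{2B|v|}`. [folklore] -/
private theorem one_add_sq_pow_le_exp (v : ℝ) (B : ℕ) : (1 + v ^ 2) ^ B ≤ Real.exp (2 * B * |v|) := by
  have h1 : 1 + v ^ 2 ≤ Real.exp (2 * |v|) := by
    have h := Real.add_one_le_exp |v|
    have h2 : Real.exp (2 * |v|) = Real.exp |v| ^ 2 := by rw [← Real.exp_nat_mul]; norm_num
    rw [h2]
    nlinarith [abs_nonneg v, sq_abs v, Real.exp_pos |v|]
  calc (1 + v ^ 2) ^ B ≤ Real.exp (2 * |v|) ^ B := pow_le_pow_left₀ (by positivity) h1 B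
    _ = Real.exp (2 * B * |v|) := by rw [← Real.exp_nat_mul]; ring_nf

/-- The profile algebra: `(1+u²)^B (1+(u−a)²) ≤ 2^B(1+T²)^B T^{4B+4} (1+((u−a)/T)²)^{2B+2}` for
`a² = T²`, `T ≥ 1`. [folklore] -/
private theorem profile_le {T : ℝ} (hT : 1 ≤ T) (B : ℕ) (u a : ℝ) (ha : a ^ 2 = T ^ 2) :
    (1 + u ^ 2) ^ B * (1 + (u - a) ^ 2) ≤
      2 ^ B * (1 + T ^ 2) ^ B * T ^ (4 * B + 4) * (1 + ((u - a) / T) ^ 2) ^ (2 * B + 2) := by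
  have hT0 : 0 < T := by linarith
  set P : ℝ := 1 + (u - a) ^ 2 with hP
  set Q : ℝ := 1 + ((u - a) / T) ^ 2 with hQ
  have hP1 : 1 ≤ P := by rw [hP]; nlinarith [sq_nonneg (u - a)]
  have hQ0 : 0 ≤ Q := by positivity
  -- (i) `P ≤ T² Q`
  have hPQ : P ≤ T ^ 2 * Q := by
    rw [hP, hQ, div_pow, mul_add, mul_one, mul_div_cancel₀ _ (pow_ne_zero 2 hT0.ne')]
    nlinarith [sq_nonneg (u - a)]
  -- (ii) `1 + u² ≤ 2(1 + a²) P`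
  have hu : 1 + u ^ 2 ≤ 2 * (1 + a ^ 2) * P := by
    rw [hP]; nlinarith [sq_nonneg (u - 2 * a), sq_nonneg a, sq_nonneg (u - a), sq_nonneg u]
  calc (1 + u ^ 2) ^ B * P ≤ (2 * (1 + a ^ 2) * P) ^ B * P :=
        mul_le_mul_of_nonneg_right (pow_le_pow_left₀ (by positivity) hu B) (by linarith)
    _ = 2 ^ B * (1 + T ^ 2) ^ B * P ^ (B + 1) := by rw [ha, mul_pow, mul_pow]; ring
    _ ≤ 2 ^ B * (1 + T ^ 2) ^ B * P ^ (2 * B + 2) :=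
        mul_le_mul_of_nonneg_left (pow_le_pow_right₀ hP1 (by omega)) (by positivity)
    _ ≤ 2 ^ B * (1 + T ^ 2) ^ B * (T ^ 2 * Q) ^ (2 * B + 2) := by gcongr
    _ = 2 ^ B * (1 + T ^ 2) ^ B * T ^ (4 * B + 4) * Q ^ (2 * B + 2) := by ring

/-- `|Φ(η)|² ≤ (2^N‖φ‖_N)² e^{4πσ|Im η|} / (1 + (Re η)²)^{2N}`. [cite: BondarenkoHeap2026, §2.1 p. 5–6 (Φ)] -/
theorem norm_PhiC_sq_le (w : Bump) (N : ℕ) (η : ℂ) :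
    ‖PhiC w η‖ ^ 2 ≤ (2 ^ N * phiNorm w N) ^ 2 * Real.exp (2 * π * w.σ * |η.im|) ^ 2 /
      (1 + η.re ^ 2) ^ (2 * N) := by
  have h1 := norm_PhiC_le w N η
  have hre : 1 + η.re ^ 2 ≤ 1 + ‖η‖ ^ 2 := by
    rw [Complex.sq_norm, Complex.normSq_apply]; nlinarith [sq_nonneg η.im]
  have hpos : 0 < (1 + η.re ^ 2) ^ N := by positivity
  have h2 : ‖PhiC w η‖ ≤ 2 ^ N * phiNorm w N * Real.exp (2 * π * w.σ * |η.im|) / (1 + η.re ^ 2) ^ N := by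
    refine h1.trans ?_
    rw [mul_right_comm]
    exact div_le_div_of_nonneg_left (by positivity [phiNorm_nonneg w N]) hpos
      (pow_le_pow_left₀ (by positivity) hre N)
  calc ‖PhiC w η‖ ^ 2 ≤ (2 ^ N * phiNorm w N * Real.exp (2 * π * w.σ * |η.im|) / (1 + η.re ^ 2) ^ N) ^ 2 :=
        pow_le_pow_left₀ (norm_nonneg _) h2 2
    _ = _ := by rw [div_pow, mul_pow, ← pow_mul, mul_comm N 2]

/-- **Two-bump majorant for `W_ℂ`:** `|W_T(u+iv)| ≤ K_W e^{(4πσ/T + 2B)|v|} ((1+(u−T)²)⁻¹ + (1+(u+T)²)⁻¹)`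
(`T ≥ 1`). [cite: BondarenkoHeap2026, §2.1 (1)–(2) p. 5] -/
theorem norm_weightC_le (w : Bump) (B : ℕ) {T : ℝ} (hT : 1 ≤ T) (ζ : ℂ) :
    ‖weightC w B T ζ‖ ≤
      ((2 ^ (B + 1) * phiNorm w (B + 1)) ^ 2 * (2 ^ B * (1 + T ^ 2) ^ B * T ^ (4 * B + 4)) / T ^ (2 * B)) *
        Real.exp ((4 * π * w.σ / T + 2 * B) * |ζ.im|) *
          ((1 + (ζ.re - T) ^ 2)⁻¹ + (1 + (ζ.re + T) ^ 2)⁻¹) := by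
  have hT0 : 0 < T := by linarith
  set u := ζ.re with hu
  set v := ζ.im with hv
  set N := B + 1 with hN
  set CΦ : ℝ := 2 ^ N * phiNorm w N with hCΦ
  have hphi := phiNorm_nonneg w N
  have hCΦ0 : 0 ≤ CΦ := by positivity
  set c : ℝ := 2 ^ B * (1 + T ^ 2) ^ B * T ^ (4 * B + 4) with hc
  set E : ℝ := Real.exp (2 * π * w.σ * (|v| / T)) with hE
  set P₁ : ℝ := 1 + (u - T) ^ 2 with hP₁
  set P₂ : ℝ := 1 + (u + T) ^ 2 with hP₂
  set Q₁ : ℝ := 1 + ((u - T) / T) ^ 2 with hQ₁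
  set Q₂ : ℝ := 1 + ((u + T) / T) ^ 2 with hQ₂
  have hP₁0 : 0 < P₁ := by positivity
  have hP₂0 : 0 < P₂ := by positivity
  have hQ₁0 : 0 < Q₁ := by positivity
  have hQ₂0 : 0 < Q₂ := by positivity
  -- the prefactor
  have hpref : ‖((ζ ^ 2 + 1 / 4) / (T : ℂ) ^ 2) ^ B‖ ≤ (1 + u ^ 2) ^ B * (1 + v ^ 2) ^ B / T ^ (2 * B) := by
    rw [norm_pow, norm_div, norm_pow, Complex.norm_real, Real.norm_eq_abs, abs_of_pos hT0, div_pow,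
      ← pow_mul, ← mul_pow]
    exact div_le_div_of_nonneg_right (pow_le_pow_left₀ (norm_nonneg _) (norm_sq_add_quarter_le ζ) B)
      (by positivity)
  -- the two `Φ` factors
  have him₁ : (ζ / T - 1).im = v / T := by simp [hv, Complex.div_ofReal_im]
  have hre₁ : (ζ / T - 1).re = (u - T) / T := by
    simp [hu, Complex.div_ofReal_re]; field_simp
  have him₂ : (ζ / T + 1).im = v / T := by simp [hv, Complex.div_ofReal_im]
  have hre₂ : (ζ / T + 1).re = (u + T) / T := by
    simp [hu, Complex.div_ofReal_re]; field_simp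
  have habs : |v / T| = |v| / T := by rw [abs_div, abs_of_pos hT0]
  have hΦ₁ : ‖PhiC w (ζ / T - 1)‖ ^ 2 ≤ CΦ ^ 2 * E ^ 2 / Q₁ ^ (2 * N) := by
    have := norm_PhiC_sq_le w N (ζ / T - 1)
    rwa [him₁, hre₁, habs] at this
  have hΦ₂ : ‖PhiC w (ζ / T + 1)‖ ^ 2 ≤ CΦ ^ 2 * E ^ 2 / Q₂ ^ (2 * N) := by
    have := norm_PhiC_sq_le w N (ζ / T + 1)
    rwa [him₂, hre₂, habs] at this
  -- the profile algebra
  have hprof₁ : (1 + u ^ 2) ^ B / Q₁ ^ (2 * N) ≤ c / P₁ := by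
    rw [div_le_div_iff₀ (by positivity) hP₁0]
    have := profile_le hT B u T rfl
    rw [show 2 * N = 2 * B + 2 by omega]
    linarith
  have hprof₂ : (1 + u ^ 2) ^ B / Q₂ ^ (2 * N) ≤ c / P₂ := by
    rw [div_le_div_iff₀ (by positivity) hP₂0]
    have := profile_le hT B u (-T) (by ring)
    rw [show 2 * N = 2 * B + 2 by omega, show u - -T = u + T by ring] at *
    linarith
  -- `(1+v²)^B E² ≤ e^{(4πσ/T + 2B)|v|}`
  have hexp : (1 + v ^ 2) ^ B * E ^ 2 ≤ Real.exp ((4 * π * w.σ / T + 2 * B) * |v|) := by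
    have h1 := one_add_sq_pow_le_exp v B
    have h2 : E ^ 2 = Real.exp (4 * π * w.σ / T * |v|) := by
      rw [hE, ← Real.exp_nat_mul]; congr 1; push_cast; field_simp; ring
    rw [h2, show (4 * π * w.σ / T + 2 * B) * |v| = 2 * B * |v| + 4 * π * w.σ / T * |v| by ring,
      Real.exp_add]
    exact mul_le_mul_of_nonneg_right h1 (Real.exp_pos _).le
  -- assemble
  have hW1 : ‖weightC w B T ζ‖ ≤ (1 + u ^ 2) ^ B * (1 + v ^ 2) ^ B / T ^ (2 * B) *
      (‖PhiC w (ζ / T - 1)‖ ^ 2 + ‖PhiC w (ζ / T + 1)‖ ^ 2) := by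
    unfold weightC
    rw [norm_mul]
    refine mul_le_mul hpref ((norm_add_le _ _).trans (by rw [norm_pow, norm_pow])) (norm_nonneg _)
      (by positivity)
  have hW2 : (1 + u ^ 2) ^ B * (‖PhiC w (ζ / T - 1)‖ ^ 2 + ‖PhiC w (ζ / T + 1)‖ ^ 2) ≤
      CΦ ^ 2 * E ^ 2 * c * (P₁⁻¹ + P₂⁻¹) := by
    have h1 : (1 + u ^ 2) ^ B * ‖PhiC w (ζ / T - 1)‖ ^ 2 ≤ CΦ ^ 2 * E ^ 2 * (c / P₁) := by
      calc (1 + u ^ 2) ^ B * ‖PhiC w (ζ / T - 1)‖ ^ 2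
          ≤ (1 + u ^ 2) ^ B * (CΦ ^ 2 * E ^ 2 / Q₁ ^ (2 * N)) :=
            mul_le_mul_of_nonneg_left hΦ₁ (by positivity)
        _ = CΦ ^ 2 * E ^ 2 * ((1 + u ^ 2) ^ B / Q₁ ^ (2 * N)) := by ring
        _ ≤ CΦ ^ 2 * E ^ 2 * (c / P₁) := mul_le_mul_of_nonneg_left hprof₁ (by positivity)
    have h2 : (1 + u ^ 2) ^ B * ‖PhiC w (ζ / T + 1)‖ ^ 2 ≤ CΦ ^ 2 * E ^ 2 * (c / P₂) := by
      calc (1 + u ^ 2) ^ B * ‖PhiC w (ζ / T + 1)‖ ^ 2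
          ≤ (1 + u ^ 2) ^ B * (CΦ ^ 2 * E ^ 2 / Q₂ ^ (2 * N)) :=
            mul_le_mul_of_nonneg_left hΦ₂ (by positivity)
        _ = CΦ ^ 2 * E ^ 2 * ((1 + u ^ 2) ^ B / Q₂ ^ (2 * N)) := by ring
        _ ≤ CΦ ^ 2 * E ^ 2 * (c / P₂) := mul_le_mul_of_nonneg_left hprof₂ (by positivity)
    have : (1 + u ^ 2) ^ B * (‖PhiC w (ζ / T - 1)‖ ^ 2 + ‖PhiC w (ζ / T + 1)‖ ^ 2) =
        (1 + u ^ 2) ^ B * ‖PhiC w (ζ / T - 1)‖ ^ 2 + (1 + u ^ 2) ^ B * ‖PhiC w (ζ / T + 1)‖ ^ 2 := by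
      ring
    rw [this, div_eq_mul_inv, div_eq_mul_inv] at *
    linarith
  calc ‖weightC w B T ζ‖
      ≤ (1 + u ^ 2) ^ B * (1 + v ^ 2) ^ B / T ^ (2 * B) *
          (‖PhiC w (ζ / T - 1)‖ ^ 2 + ‖PhiC w (ζ / T + 1)‖ ^ 2) := hW1
    _ = (1 + v ^ 2) ^ B / T ^ (2 * B) *
          ((1 + u ^ 2) ^ B * (‖PhiC w (ζ / T - 1)‖ ^ 2 + ‖PhiC w (ζ / T + 1)‖ ^ 2)) := by ring
    _ ≤ (1 + v ^ 2) ^ B / T ^ (2 * B) * (CΦ ^ 2 * E ^ 2 * c * (P₁⁻¹ + P₂⁻¹)) :=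
          mul_le_mul_of_nonneg_left hW2 (by positivity)
    _ = CΦ ^ 2 * c / T ^ (2 * B) * ((1 + v ^ 2) ^ B * E ^ 2) * (P₁⁻¹ + P₂⁻¹) := by ring
    _ ≤ CΦ ^ 2 * c / T ^ (2 * B) * Real.exp ((4 * π * w.σ / T + 2 * B) * |v|) * (P₁⁻¹ + P₂⁻¹) := by
          gcongr
    _ = _ := by rw [hCΦ, hc, hN]

/-- The band-limit / exponential-type parameter `Δ = log L/π + 2σ/T + B + 1` used for `B_{T,h}`
(any `Δ ≥ log L/2π + 2σ/T` bounds `supp B̂`; the extra room absorbs the polynomial prefactor).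
[cite: BondarenkoHeap2026, §2.2 p. 6 (B̂ has compact support)] -/
def Delta (w : Bump) (B : ℕ) (L T : ℝ) : ℝ :=
  Real.log L / π + 2 * w.σ / T + B + 1

/-- `Δ > 0` for `L ≥ 1`, `T > 0`. [cite: BondarenkoHeap2026, §2.2 p. 6 (B̂ has compact support)] -/
theorem Delta_pos (w : Bump) (B : ℕ) {L T : ℝ} (hL : 1 ≤ L) (hT : 0 < T) : 0 < Delta w B L T := by
  unfold Delta
  have := Real.log_nonneg hL
  have := w.σ_pos
  positivity

/-- **Two-bump majorant for `G`:** `|G(u+iv)| ≤ K₀ e^{2πΔ|v|}((1+(u−T)²)⁻¹ + (1+(u+T)²)⁻¹)`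
(`L, T ≥ 1`). [cite: BondarenkoHeap2026, §2.2 p. 6 (B_{T,h}(z))] -/
theorem exists_bound_GC (w : Bump) (B : ℕ) (r : ℕ → ℝ) {L T : ℝ} (hL : 1 ≤ L) (hT : 1 ≤ T) :
    ∃ K₀ : ℝ, 0 ≤ K₀ ∧ ∀ ζ : ℂ, ‖GC w B r L T ζ‖ ≤
      K₀ * Real.exp (2 * π * Delta w B L T * |ζ.im|) *
        ((1 + (ζ.re - T) ^ 2)⁻¹ + (1 + (ζ.re + T) ^ 2)⁻¹) := by
  have hT0 : 0 < T := by linarith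
  set S : ℝ := ∑ n ∈ Finset.Icc 1 ⌊L⌋₊, |r n| with hS
  have hS0 : 0 ≤ S := Finset.sum_nonneg fun _ _ ↦ abs_nonneg _
  set KW : ℝ := (2 ^ (B + 1) * phiNorm w (B + 1)) ^ 2 * (2 ^ B * (1 + T ^ 2) ^ B * T ^ (4 * B + 4)) /
    T ^ (2 * B) with hKW
  have hphi := phiNorm_nonneg w (B + 1)
  have hKW0 : 0 ≤ KW := by positivity
  refine ⟨S ^ 2 * KW, by positivity, fun ζ ↦ ?_⟩
  have hR := norm_dirichletPolyC_le hL r ζ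
  have hRb := norm_dirichletPolyBarC_le hL r ζ
  have hW := norm_weightC_le w B hT ζ
  set v := ζ.im
  set Pr : ℝ := (1 + (ζ.re - T) ^ 2)⁻¹ + (1 + (ζ.re + T) ^ 2)⁻¹ with hPr
  have hPr0 : 0 ≤ Pr := by positivity
  -- the exponential rates add up to at most `2πΔ`
  have hrate : Real.exp (|v| * Real.log L) * Real.exp (|v| * Real.log L) *
      Real.exp ((4 * π * w.σ / T + 2 * B) * |v|) ≤ Real.exp (2 * π * Delta w B L T * |v|) := by
    rw [← Real.exp_add, ← Real.exp_add, Real.exp_le_exp]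
    unfold Delta
    have hlog : 0 ≤ Real.log L := Real.log_nonneg hL
    have hπ : (1 : ℝ) ≤ π := le_trans (by norm_num) Real.two_le_pi
    have hv0 : 0 ≤ |v| := abs_nonneg v
    have h1 : (4 * π * w.σ / T + 2 * B) * |v| ≤ (4 * π * w.σ / T + 2 * π * B + 2 * π) * |v| := by
      apply mul_le_mul_of_nonneg_right _ hv0
      nlinarith [w.σ_pos, (Nat.cast_nonneg B : (0 : ℝ) ≤ B)]
    have h2 : 2 * π * (Real.log L / π + 2 * w.σ / T + B + 1) * |v| =
        |v| * Real.log L + |v| * Real.log L + (4 * π * w.σ / T + 2 * π * B + 2 * π) * |v| := by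
      field_simp; ring
    rw [h2]; linarith
  calc ‖GC w B r L T ζ‖ = ‖dirichletPolyC r L ζ‖ * ‖dirichletPolyBarC r L ζ‖ * ‖weightC w B T ζ‖ := by
        unfold GC; rw [norm_mul, norm_mul]
    _ ≤ (S * Real.exp (|v| * Real.log L)) * (S * Real.exp (|v| * Real.log L)) *
          (KW * Real.exp ((4 * π * w.σ / T + 2 * B) * |v|) * Pr) :=
        mul_le_mul (mul_le_mul hR hRb (norm_nonneg _) (by positivity)) hW (norm_nonneg _) (by positivity)
    _ = S ^ 2 * KW * (Real.exp (|v| * Real.log L) * Real.exp (|v| * Real.log L) *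
          Real.exp ((4 * π * w.σ / T + 2 * B) * |v|)) * Pr := by ring
    _ ≤ S ^ 2 * KW * Real.exp (2 * π * Delta w B L T * |v|) * Pr := by gcongr

/-- Shifting a bump by `|s| ≤ 1/2` costs a factor `4`. [folklore] -/
private theorem inv_one_add_sq_shift_le (x a s : ℝ) (hs : |s| ≤ 1 / 2) :
    (1 + (x + s - a) ^ 2)⁻¹ ≤ 4 * (1 + (x - a) ^ 2)⁻¹ := by
  rw [← div_eq_mul_inv, le_div_iff₀ (by positivity), inv_mul_eq_div, div_le_iff₀ (by positivity)]
  have := abs_le.mp hs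
  nlinarith [sq_nonneg (x - a + 2 * s), sq_nonneg s, sq_nonneg (x - a)]

/-- **Two-bump majorant for `B_{T,h}`** (the growth hypothesis of the explicit formula):
`|B_{T,h}(x+iy)| ≤ K e^{2πΔ|y|}((1+(x−T)²)⁻¹ + (1+(x+T)²)⁻¹)` for `L, T ≥ 1`, `0 ≤ h ≤ 1`.
[cite: BondarenkoHeap2026, §2.2 p. 6 (B_{T,h}(z))] -/
theorem exists_bound_BC (c : ℝ) (w : Bump) (B : ℕ) (r : ℕ → ℝ) {L T : ℝ} (hL : 1 ≤ L) (hT : 1 ≤ T)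
    (hh0 : 0 ≤ gapWidth c T) (hh1 : gapWidth c T ≤ 1) :
    ∃ K : ℝ, 0 ≤ K ∧ ∀ z : ℂ, ‖BC c w B r L T z‖ ≤
      K * Real.exp (2 * π * Delta w B L T * |z.im|) *
        ((1 + (z.re - T) ^ 2)⁻¹ + (1 + (z.re + T) ^ 2)⁻¹) := by
  obtain ⟨K₀, hK₀, hG⟩ := exists_bound_GC w B r hL hT
  refine ⟨4 * K₀, by positivity, fun z ↦ ?_⟩
  unfold BC
  have hbound : ∀ s ∈ Set.uIoc (-(gapWidth c T / 2)) (gapWidth c T / 2),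
      ‖GC w B r L T (s + z)‖ ≤ 4 * K₀ * Real.exp (2 * π * Delta w B L T * |z.im|) *
        ((1 + (z.re - T) ^ 2)⁻¹ + (1 + (z.re + T) ^ 2)⁻¹) := by
    intro s hs
    have hs' : |s| ≤ 1 / 2 := by
      rw [Set.uIoc_of_le (by linarith)] at hs
      rw [abs_le]; constructor <;> linarith [hs.1, hs.2]
    have h := hG (s + z)
    have him : ((s : ℂ) + z).im = z.im := by simp
    have hre : ((s : ℂ) + z).re = z.re + s := by simp; ring
    rw [him, hre] at h
    have h1 := inv_one_add_sq_shift_le z.re T s hs'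
    have h2 := inv_one_add_sq_shift_le z.re (-T) s hs'
    rw [show z.re + s - -T = z.re + s + T by ring, show z.re - -T = z.re + T by ring] at h2
    have hE : 0 ≤ K₀ * Real.exp (2 * π * Delta w B L T * |z.im|) := by positivity
    calc ‖GC w B r L T (↑s + z)‖ ≤ K₀ * Real.exp (2 * π * Delta w B L T * |z.im|) *
          ((1 + (z.re + s - T) ^ 2)⁻¹ + (1 + (z.re + s + T) ^ 2)⁻¹) := h
      _ ≤ K₀ * Real.exp (2 * π * Delta w B L T * |z.im|) *
          (4 * (1 + (z.re - T) ^ 2)⁻¹ + 4 * (1 + (z.re + T) ^ 2)⁻¹) :=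
          mul_le_mul_of_nonneg_left (add_le_add h1 h2) hE
      _ = _ := by ring
  refine (intervalIntegral.norm_integral_le_of_norm_le_const hbound).trans ?_
  rw [show gapWidth c T / 2 - -(gapWidth c T / 2) = gapWidth c T by ring, abs_of_nonneg hh0]
  have hE : 0 ≤ 4 * K₀ * Real.exp (2 * π * Delta w B L T * |z.im|) *
      ((1 + (z.re - T) ^ 2)⁻¹ + (1 + (z.re + T) ^ 2)⁻¹) := by positivity
  calc _ ≤ 4 * K₀ * Real.exp (2 * π * Delta w B L T * |z.im|) *
        ((1 + (z.re - T) ^ 2)⁻¹ + (1 + (z.re + T) ^ 2)⁻¹) * 1 := by gcongr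
    _ = _ := mul_one _

/-! ### The polar terms `B_{T,h}(±i/2)` -/

/-- `|ζ² + 1/4| ≤ 1` for `|Re ζ| ≤ 1/2`, `|Im ζ| = 1/2` (the prefactor of `W_T` at the poles is
`≤ T^{−2B}`). [cite: BondarenkoHeap2026, §2.2 p. 6 (polar terms)] -/
theorem norm_sq_add_quarter_le_one {ζ : ℂ} (hre : |ζ.re| ≤ 1 / 2) (him : |ζ.im| = 1 / 2) :
    ‖ζ ^ 2 + 1 / 4‖ ≤ 1 := by
  have hs : ζ.re ^ 2 ≤ 1 / 4 := by
    have := abs_le.mp hre; nlinarith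
  have hv : ζ.im ^ 2 = 1 / 4 := by
    rw [← sq_abs, him]; norm_num
  rw [← sq_le_one_iff₀ (norm_nonneg _), Complex.sq_norm, Complex.normSq_apply]
  have h1 : (ζ ^ 2 + 1 / 4).re = ζ.re ^ 2 - ζ.im ^ 2 + 1 / 4 := by
    simp [pow_two, Complex.mul_re]
  have h2 : (ζ ^ 2 + 1 / 4).im = 2 * ζ.re * ζ.im := by
    simp [pow_two, Complex.mul_im]; ring
  rw [h1, h2, hv]
  nlinarith [sq_nonneg ζ.re]

/-- `|G(s ± i/2)| ≤ (Σ|r(n)|)² L · 2e^{2πσ}‖φ‖₁² · T^{−2B}` for `|s| ≤ 1/2` (`L, T ≥ 1`): the size of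
the integrand of the polar terms. [cite: BondarenkoHeap2026, §2.2 p. 6 (polar terms)] -/
theorem norm_GC_half_le (w : Bump) (B : ℕ) (r : ℕ → ℝ) {L T : ℝ} (hL : 1 ≤ L) (hT : 1 ≤ T)
    {ζ : ℂ} (hre : |ζ.re| ≤ 1 / 2) (him : |ζ.im| = 1 / 2) :
    ‖GC w B r L T ζ‖ ≤ (∑ n ∈ Finset.Icc 1 ⌊L⌋₊, |r n|) ^ 2 * L *
      (2 * Real.exp (2 * π * w.σ) * (∫ ξ : ℝ, ‖(w.φ ξ : ℂ)‖) ^ 2) / T ^ (2 * B) := by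
  have hT0 : 0 < T := by linarith
  have hL0 : 0 < L := by linarith
  set S : ℝ := ∑ n ∈ Finset.Icc 1 ⌊L⌋₊, |r n| with hS
  have hS0 : 0 ≤ S := Finset.sum_nonneg fun _ _ ↦ abs_nonneg _
  set Φ₁ : ℝ := ∫ ξ : ℝ, ‖(w.φ ξ : ℂ)‖ with hΦ₁
  have hΦ₁0 : 0 ≤ Φ₁ := integral_nonneg fun _ ↦ norm_nonneg _
  -- `R`, `R̄`
  have hR := norm_dirichletPolyC_le hL r ζ
  have hRb := norm_dirichletPolyBarC_le hL r ζ
  rw [him] at hR hRb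
  have hsq : Real.exp (1 / 2 * Real.log L) * Real.exp (1 / 2 * Real.log L) = L := by
    rw [← Real.exp_add, show 1 / 2 * Real.log L + 1 / 2 * Real.log L = Real.log L by ring,
      Real.exp_log hL0]
  have hRR : ‖dirichletPolyC r L ζ‖ * ‖dirichletPolyBarC r L ζ‖ ≤ S ^ 2 * L := by
    calc _ ≤ (S * Real.exp (1 / 2 * Real.log L)) * (S * Real.exp (1 / 2 * Real.log L)) :=
          mul_le_mul hR hRb (norm_nonneg _) (by positivity)
      _ = S ^ 2 * (Real.exp (1 / 2 * Real.log L) * Real.exp (1 / 2 * Real.log L)) := by ring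
      _ = S ^ 2 * L := by rw [hsq]
  -- `W`
  have hpref : ‖((ζ ^ 2 + 1 / 4) / (T : ℂ) ^ 2) ^ B‖ ≤ 1 / T ^ (2 * B) := by
    rw [norm_pow, norm_div, norm_pow, Complex.norm_real, Real.norm_eq_abs, abs_of_pos hT0, pow_mul,
      ← one_div_pow]
    refine pow_le_pow_left₀ (by positivity) ?_ B
    rw [div_le_div_iff_of_pos_right (by positivity)]
    exact norm_sq_add_quarter_le_one hre him
  have hΦ : ∀ η : ℂ, |η.im| = 1 / 2 / T → ‖PhiC w η‖ ≤ Real.exp (π * w.σ) * Φ₁ := by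
    intro η hη
    refine (norm_PhiC_le_exp w η).trans (mul_le_mul_of_nonneg_right ?_ hΦ₁0)
    rw [Real.exp_le_exp, hη]
    have h12 : 1 / 2 / T ≤ 1 / 2 := by
      rw [div_le_iff₀ hT0]; linarith
    have hσ := w.σ_pos
    have := mul_le_mul_of_nonneg_left h12 (by positivity : 0 ≤ 2 * π * w.σ)
    linarith
  have him₁ : |(ζ / T - 1).im| = 1 / 2 / T := by
    simp [Complex.div_ofReal_im, abs_div, him, abs_of_pos hT0]
  have him₂ : |(ζ / T + 1).im| = 1 / 2 / T := by
    simp [Complex.div_ofReal_im, abs_div, him, abs_of_pos hT0]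
  have hΦsum : ‖PhiC w (ζ / T - 1) ^ 2 + PhiC w (ζ / T + 1) ^ 2‖ ≤ 2 * Real.exp (2 * π * w.σ) * Φ₁ ^ 2 := by
    refine (norm_add_le _ _).trans ?_
    rw [norm_pow, norm_pow]
    have h1 := pow_le_pow_left₀ (norm_nonneg _) (hΦ _ him₁) 2
    have h2 := pow_le_pow_left₀ (norm_nonneg _) (hΦ _ him₂) 2
    have h3 : (Real.exp (π * w.σ) * Φ₁) ^ 2 = Real.exp (2 * π * w.σ) * Φ₁ ^ 2 := by
      rw [mul_pow, ← Real.exp_nat_mul]; ring_nf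
    linarith
  have hW : ‖weightC w B T ζ‖ ≤ 1 / T ^ (2 * B) * (2 * Real.exp (2 * π * w.σ) * Φ₁ ^ 2) := by
    unfold weightC
    rw [norm_mul]
    exact mul_le_mul hpref hΦsum (norm_nonneg _) (by positivity)
  calc ‖GC w B r L T ζ‖ = ‖dirichletPolyC r L ζ‖ * ‖dirichletPolyBarC r L ζ‖ * ‖weightC w B T ζ‖ := by
        unfold GC; rw [norm_mul, norm_mul]
    _ ≤ S ^ 2 * L * (1 / T ^ (2 * B) * (2 * Real.exp (2 * π * w.σ) * Φ₁ ^ 2)) :=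
        mul_le_mul hRR hW (norm_nonneg _) (by positivity)
    _ = _ := by ring

/-- **The polar terms:** `|B_{T,h}(z₀)| ≤ h (Σ|r(n)|)² L · 2e^{2πσ}‖φ‖₁² T^{−2B}` for `z₀ = ±i/2`
(`Re z₀ = 0`, `|Im z₀| = 1/2`; `L, T ≥ 1`, `0 ≤ h ≤ 1`) — "`B_{T,h}(±i/2) ≪ L^{1+ε} T^{−2B}`" (p. 6).
[cite: BondarenkoHeap2026, §2.2 p. 6 (polar terms)] -/
theorem norm_BC_polar_le (c : ℝ) (w : Bump) (B : ℕ) (r : ℕ → ℝ) {L T : ℝ} (hL : 1 ≤ L) (hT : 1 ≤ T)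
    (hh0 : 0 ≤ gapWidth c T) (hh1 : gapWidth c T ≤ 1) {z₀ : ℂ} (hre : z₀.re = 0)
    (him : |z₀.im| = 1 / 2) :
    ‖BC c w B r L T z₀‖ ≤ gapWidth c T * ((∑ n ∈ Finset.Icc 1 ⌊L⌋₊, |r n|) ^ 2 * L *
      (2 * Real.exp (2 * π * w.σ) * (∫ ξ : ℝ, ‖(w.φ ξ : ℂ)‖) ^ 2) / T ^ (2 * B)) := by
  unfold BC
  have hbound : ∀ s ∈ Set.uIoc (-(gapWidth c T / 2)) (gapWidth c T / 2),
      ‖GC w B r L T (s + z₀)‖ ≤ (∑ n ∈ Finset.Icc 1 ⌊L⌋₊, |r n|) ^ 2 * L *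
        (2 * Real.exp (2 * π * w.σ) * (∫ ξ : ℝ, ‖(w.φ ξ : ℂ)‖) ^ 2) / T ^ (2 * B) := by
    intro s hs
    rw [Set.uIoc_of_le (by linarith)] at hs
    refine norm_GC_half_le w B r hL hT ?_ ?_
    · simp only [Complex.add_re, Complex.ofReal_re, hre, add_zero]
      rw [abs_le]; constructor <;> linarith [hs.1, hs.2]
    · simp only [Complex.add_im, Complex.ofReal_im, zero_add, him]
  refine (intervalIntegral.norm_integral_le_of_norm_le_const hbound).trans (le_of_eq ?_)
  rw [show gapWidth c T / 2 - -(gapWidth c T / 2) = gapWidth c T by ring, abs_of_nonneg hh0]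
  ring

/-! ### Integrability of `B_{T,h}(u) Re ψ(¼ + iu/2)` (hypothesis of the explicit formula) -/

open Literature.Analysis.SpecialFunctions in
/-- **`u ↦ B_{T,h}(u) Re Γ'/Γ(¼ + iu/2)` is integrable** (`L, T ≥ 1`, `B ≥ 2`, `0 ≤ h ≤ 1`): on
`|u| ≤ 2T+1` by continuity, beyond by the decay `B_{T,h}(u) ≪ (T/|u|)^{2B}` of the weight against
`Re ψ(¼+iu/2) ≪ 1 + u²`. [cite: BondarenkoHeap2026, §2.2 p. 6 (Gamma factor integral)] -/
theorem integrable_BC_mul_reDigammaQuarter (c : ℝ) (w : Bump) (B : ℕ) (r : ℕ → ℝ) {L T : ℝ}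
    (hL : 1 ≤ L) (hT : 1 ≤ T) (hB : 2 ≤ B) (hh0 : 0 ≤ gapWidth c T) (hh1 : gapWidth c T ≤ 1) :
    Integrable fun u : ℝ ↦ BC c w B r L T u * (reDigammaQuarter u : ℂ) := by
  have hT0 : 0 < T := by linarith
  obtain ⟨D, hD0, hD⟩ := Extension.exists_weight_tail_bound w B
  set S : ℝ := ∑ n ∈ Finset.Icc 1 ⌊L⌋₊, |r n| with hS
  have hS0 : 0 ≤ S := Finset.sum_nonneg fun _ _ ↦ abs_nonneg _
  set h : ℝ := gapWidth c T with hh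
  set ρ₀ : ℝ := |reDigammaQuarter 0| with hρ₀
  -- `|R(t)| ≤ S` on the real line
  have hR : ∀ t : ℝ, ‖dirichletPoly r L t‖ ≤ S := fun t ↦ by
    have h1 := norm_dirichletPolyC_le hL r t
    rw [dirichletPolyC_ofReal] at h1
    simpa using h1
  -- continuity of the integrand
  have hcont : Continuous fun u : ℝ ↦ BC c w B r L T u * (reDigammaQuarter u : ℂ) :=
    ((differentiable_BC c w B r L T).continuous.comp continuous_ofReal).mul
      (continuous_ofReal.comp continuous_reDigammaQuarter)
  -- the compact part
  obtain ⟨Mc, hMc⟩ := (isCompact_Icc (a := -(2 * T + 1)) (b := 2 * T + 1)).exists_bound_of_continuousOn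
    hcont.continuousOn
  have hMc0 : 0 ≤ Mc := le_trans (norm_nonneg _) (hMc 0 ⟨by linarith, by linarith⟩)
  -- the tail constant
  set Ct : ℝ := h * (S ^ 2 * D * (2 * T) ^ (2 * B)) * (ρ₀ + 27) with hCt
  have hCt0 : 0 ≤ Ct := by positivity
  set K : ℝ := Mc * (1 + (2 * T + 1) ^ 2) + 2 * Ct with hK
  refine Integrable.mono' (integrable_inv_one_add_sq.const_mul K) hcont.aestronglyMeasurable
    (ae_of_all _ fun u ↦ ?_)
  have hu2 : 0 < 1 + u ^ 2 := by positivity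
  by_cases hu : |u| ≤ 2 * T + 1
  · -- compact part: `≤ Mc ≤ Mc (1 + (2T+1)²)/(1 + u²)`
    have h1 := hMc u (abs_le.mp hu)
    have h2 : Mc ≤ Mc * (1 + (2 * T + 1) ^ 2) * (1 + u ^ 2)⁻¹ := by
      rw [mul_assoc, ← div_eq_mul_inv]
      refine le_mul_of_one_le_right hMc0 ?_
      rw [one_le_div hu2]
      have := abs_le.mp hu
      nlinarith [sq_abs u]
    calc _ ≤ Mc := h1
      _ ≤ Mc * (1 + (2 * T + 1) ^ 2) * (1 + u ^ 2)⁻¹ := h2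
      _ ≤ K * (1 + u ^ 2)⁻¹ := by
          refine mul_le_mul_of_nonneg_right ?_ (by positivity)
          rw [hK]; linarith
  · -- the tail
    rw [not_le] at hu
    have hu1 : 1 ≤ |u| := by linarith
    have hu0 : 0 < |u| := by linarith
    -- size of `B(u)`
    have hwin : ∀ t ∈ Set.Icc (u - h / 2) (u + h / 2),
        ‖‖dirichletPoly r L t‖ ^ 2 * weight w B T t‖ ≤ S ^ 2 * D * (2 * T) ^ (2 * B) / |u| ^ (2 * B) := by
      intro t ht
      rw [Real.norm_eq_abs, abs_of_nonneg (mul_nonneg (sq_nonneg _) (weight_nonneg w B T t))]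
      have htu : |t - u| ≤ 1 / 2 := by
        rw [abs_le]; constructor <;> linarith [ht.1, ht.2]
      have ht1 : |u| - 1 / 2 ≤ |t| := by
        have := abs_sub_abs_le_abs_sub u t; rw [abs_sub_comm] at this; linarith
      have ht2T : 2 * T ≤ |t| := by linarith
      have htpos : 0 < |t| := by linarith
      have hWt := hD T t hT ht2T
      have hratio : T / |t| ≤ 2 * T / |u| := by
        rw [div_le_div_iff₀ htpos hu0]; nlinarith
      have hpow : (T / |t|) ^ (2 * B) ≤ (2 * T / |u|) ^ (2 * B) :=
        pow_le_pow_left₀ (by positivity) hratio _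
      calc ‖dirichletPoly r L t‖ ^ 2 * weight w B T t ≤ S ^ 2 * (D * (2 * T / |u|) ^ (2 * B)) :=
            mul_le_mul (pow_le_pow_left₀ (norm_nonneg _) (hR t) 2)
              (hWt.trans (mul_le_mul_of_nonneg_left hpow hD0)) (weight_nonneg w B T t) (by positivity)
        _ = S ^ 2 * D * (2 * T) ^ (2 * B) / |u| ^ (2 * B) := by rw [div_pow]; ring
    have hBC : ‖BC c w B r L T u‖ ≤ h * (S ^ 2 * D * (2 * T) ^ (2 * B) / |u| ^ (2 * B)) := by
      rw [BC_ofReal hh0, Complex.norm_real]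
      have h1 := norm_setIntegral_le_of_norm_le_const
        (measure_Icc_lt_top : volume (Set.Icc (u - h / 2) (u + h / 2)) < ⊤) hwin
      rw [Real.volume_real_Icc_of_le (by linarith)] at h1
      rw [show u + gapWidth c T / 2 - (u - gapWidth c T / 2) = h by rw [hh]; ring] at h1
      linarith
    -- size of `Re ψ`
    have hρ : ‖(reDigammaQuarter u : ℂ)‖ ≤ (ρ₀ + 27) * u ^ 2 := by
      rw [Complex.norm_real, Real.norm_eq_abs]
      have h1 := abs_reDigammaQuarter_le u
      have hu2' : 1 ≤ u ^ 2 := by nlinarith [sq_abs u]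
      nlinarith [abs_nonneg (reDigammaQuarter 0)]
    -- combine
    have hkey : u ^ 2 / |u| ^ (2 * B) ≤ 2 * (1 + u ^ 2)⁻¹ := by
      have hu2' : 1 ≤ u ^ 2 := by nlinarith [sq_abs u]
      have h4 : |u| ^ 4 ≤ |u| ^ (2 * B) := pow_le_pow_right₀ hu1 (by omega)
      have hu4 : u ^ 4 = |u| ^ 4 := by
        rw [show (4 : ℕ) = 2 * 2 by norm_num, pow_mul, pow_mul, sq_abs]
      have hmain : u ^ 2 * (1 + u ^ 2) ≤ 2 * |u| ^ (2 * B) := by nlinarith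
      rw [div_le_iff₀ (by positivity)]
      calc u ^ 2 = u ^ 2 * (1 + u ^ 2) * (1 + u ^ 2)⁻¹ := by field_simp
        _ ≤ 2 * |u| ^ (2 * B) * (1 + u ^ 2)⁻¹ := mul_le_mul_of_nonneg_right hmain (by positivity)
        _ = 2 * (1 + u ^ 2)⁻¹ * |u| ^ (2 * B) := by ring
    calc ‖BC c w B r L T u * (reDigammaQuarter u : ℂ)‖
        = ‖BC c w B r L T u‖ * ‖(reDigammaQuarter u : ℂ)‖ := norm_mul _ _
      _ ≤ h * (S ^ 2 * D * (2 * T) ^ (2 * B) / |u| ^ (2 * B)) * ((ρ₀ + 27) * u ^ 2) :=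
          mul_le_mul hBC hρ (norm_nonneg _) (by positivity)
      _ = Ct * (u ^ 2 / |u| ^ (2 * B)) := by rw [hCt]; ring
      _ ≤ Ct * (2 * (1 + u ^ 2)⁻¹) := mul_le_mul_of_nonneg_left hkey hCt0
      _ ≤ K * (1 + u ^ 2)⁻¹ := by
          rw [hK, ← mul_assoc]
          refine mul_le_mul_of_nonneg_right ?_ (by positivity)
          nlinarith [hMc0, sq_nonneg (2 * T + 1)]

/-! ### The explicit formula for `B_{T,h}` -/

open Literature.Analysis.SpecialFunctions in
/-- **The explicit formula applied to `B_{T,h}`** ("By the explicit formula (see e.g. Theorem 5.12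
of Iwaniec–Kowalski) applied to `B_{T,h}(u)` we find `I₁ = −2 Σ_n Λ(n)/√n Re B̂_{T,h}(log n/2π) +
(1/2π)∫ B_{T,h}(u) Re Γ'/Γ(¼ + iu/2) du − B̂_{T,h}(0) log π + B_{T,h}(i/2) + B_{T,h}(−i/2)`", p. 6),
here in the normalisation of the tree's Guinand–Weil formula `tsum_zeros_shift_eq_explicit`
(Balazard–de Roton 2008, Prop. 11) at `t = 0`, whose four hypotheses are `differentiable_BC`,
`exists_bound_BC`, `fourier_BC_eq_zero` and `integrable_BC_mul_reDigammaQuarter`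
(`L, T ≥ 1`, `B ≥ 2`, `0 < h ≤ 1`; RH is the antecedent, as in `proposition1`).
[cite: BondarenkoHeap2026, §2.2 p. 6 (explicit formula applied to B_{T,h})] -/
theorem explicit_formula_BC (hRH : RiemannHypothesis) (c : ℝ) (w : Bump) (B : ℕ) (r : ℕ → ℝ)
    {L T : ℝ} (hL : 1 ≤ L) (hT : 1 ≤ T) (hB : 2 ≤ B) (hh0 : 0 < gapWidth c T)
    (hh1 : gapWidth c T ≤ 1) :
    (Summable fun ρ : ZetaZeros.riemannZetaNontrivialZeros ↦
        ‖(riemannZetaZeroOrder (ρ : ℂ) : ℂ) * BC c w B r L T (((ρ : ℂ).im : ℝ) : ℂ)‖) ∧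
    ∑' ρ : ZetaZeros.riemannZetaNontrivialZeros,
        (riemannZetaZeroOrder (ρ : ℂ) : ℂ) * BC c w B r L T (((ρ : ℂ).im : ℝ) : ℂ) =
      BC c w B r L T (I / 2) + BC c w B r L T (-(I / 2))
      - ∑' n : ℕ, ((ArithmeticFunction.vonMangoldt n : ℝ) : ℂ) / (Real.sqrt n : ℂ) *
          ((1 / (2 * π) : ℂ) * (𝓕 (fun x : ℝ ↦ BC c w B r L T x) (Real.log n / (2 * π))
            + 𝓕 (fun x : ℝ ↦ BC c w B r L T x) (-(Real.log n / (2 * π)))))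
      + ((1 / (2 * π) : ℂ) * (∫ u : ℝ, BC c w B r L T u * (reDigammaQuarter u : ℂ))
        - (1 / (2 * π) : ℂ) * 𝓕 (fun x : ℝ ↦ BC c w B r L T x) 0 * (Real.log π : ℂ)) := by
  have hT0 : 0 < T := by linarith
  obtain ⟨K, hK, hb⟩ := exists_bound_BC c w B r hL hT hh0.le hh1
  have hsupp : ∀ ξ : ℝ, Delta w B L T ≤ |ξ| → 𝓕 (fun x : ℝ ↦ BC c w B r L T x) ξ = 0 := by
    intro ξ hξ
    refine fourier_BC_eq_zero hT0 hh0 hL w B r ?_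
    have hlog : 0 ≤ Real.log L := Real.log_nonneg hL
    have h1 : Real.log L / (2 * π) ≤ Real.log L / π :=
      div_le_div_of_nonneg_left hlog Real.pi_pos (by linarith [Real.pi_pos])
    have hB0 : (0 : ℝ) ≤ B := Nat.cast_nonneg B
    unfold Delta at hξ
    linarith
  have hA : Integrable fun u : ℝ ↦ BC c w B r L T ((u - 0 : ℝ) : ℂ) * (reDigammaQuarter u : ℂ) := by
    simpa only [sub_zero] using integrable_BC_mul_reDigammaQuarter c w B r hL hT hB hh0.le hh1
  have h := Literature.NumberTheory.LFunctions.tsum_zeros_shift_eq_explicit hRH (a := T) (b := -T)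
    (Delta_pos w B hL hT0) (differentiable_BC c w B r L T) hK
    (fun z ↦ by rw [sub_neg_eq_add]; exact hb z) hsupp hA
  simp only [sub_zero, Complex.ofReal_zero, zero_mul, neg_zero, Complex.exp_zero, one_mul] at h
  exact h

end Prop1

end BondarenkoHeap2026

end Literature.NumberTheory.LFunctions

end
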